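import Literature.Computability.Complexity.NumProgramsDiv
import HarnessLib

/-!
# Numeric register programs, VI b: division with remainder by a monic polynomial

Literature / complexity toolkit, continuing `NumProgramsDiv.lean` (Newton inversion `invP`,
reversal `revP`, coefficientwise combinations `linP`, the mathematics `div_remainder_eq`).
This file is the program **`divP`** — von zur Gathen–Gerhard 2013, Algorithm 9.5 (fast division
with remainder) in the square case `|A| = 2d`, `|B| = d + 1` used by the remainder tree — with
its specification **`divP_spec`** (the remainder `coeffList N d (a mod b)` is appended to the
output accumulator; frame; `peak`; `steps`; the multiplier's precondition at every call).

## References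

* J. von zur Gathen, J. Gerhard, *Modern Computer Algebra*, 3rd ed., CUP 2013, §9.1
  (Algorithm 9.5, Theorem 9.6) [GathenGerhard2013].
* D. Harvey, *An exponent one-fifth algorithm for deterministic integer factorisation*, Math.
  Comp. 90 (2021), §2.3 [Harvey2021].
-/

namespace Literature.Computability.Complexity

open _root_.Computability Polynomial

namespace NCom

variable {S V O X E : Type} [DecidableEq S] [DecidableEq V] [DecidableEq O] {𝓔 : NExt S V O X E}

/-! ### Division with remainder by a monic polynomial -/

/-- Scalar roles of `divP`: those of `invP` (including the multiplier's and `linP`'s), the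
degree `d`, scratch. [folklore] -/
inductive DivS where
  | iv (i : InvS) | d | d1 | d2 | dm
  deriving DecidableEq

/-- Queue roles of `divP`: those of `invP`, the dividend `DA`, the divisor `DB`, two scratch
queues, the quotient. [folklore] -/
inductive DivV where
  | vv (i : InvV) | DA | DB | T | T2 | Q
  deriving DecidableEq

/-- Accumulator roles of `divP`: those of `invP` and the remainder output. [folklore] -/
inductive DivO where
  | vo (i : InvO) | accR
  deriving DecidableEq

/-- Embedding of the inversion's scalar roles. [folklore] -/
def DivS.ivE : InvS ↪ DivS := ⟨DivS.iv, fun _ _ h => DivS.iv.inj h⟩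
/-- Embedding of the inversion's queue roles. [folklore] -/
def DivV.vvE : InvV ↪ DivV := ⟨DivV.vv, fun _ _ h => DivV.vv.inj h⟩
/-- Embedding of the inversion's accumulator roles. [folklore] -/
def DivO.voE : InvO ↪ DivO := ⟨DivO.vo, fun _ _ h => DivO.vo.inj h⟩

/-- Unfolding the embedding. [folklore] -/
@[simp] theorem DivS.ivE_apply (i : InvS) : DivS.ivE i = .iv i := rfl
/-- Unfolding the embedding. [folklore] -/
@[simp] theorem DivV.vvE_apply (i : InvV) : DivV.vvE i = .vv i := rfl
/-- Unfolding the embedding. [folklore] -/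
@[simp] theorem DivO.voE_apply (i : InvO) : DivO.voE i = .vo i := rfl

section Div

variable (M : Multiplier 𝓔) (ρ : DivS ↪ S) (ν : DivV ↪ V) (ω : DivO ↪ O)

local notation "ρi" => (DivS.ivE.trans ρ)
local notation "νi" => (DivV.vvE.trans ν)
local notation "ωi" => (DivO.voE.trans ω)
local notation "ρq" => (InvS.pmE.trans (DivS.ivE.trans ρ))
local notation "νq" => (InvV.pvE.trans (DivV.vvE.trans ν))
local notation "ρm" => (InvS.lnE.trans (DivS.ivE.trans ρ))

/-- the transfer scalar -/ local notation "𝔵" => ρ (DivS.iv (InvS.pm PMulS.x))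
/-- the transfer accumulator -/ local notation "𝔞" => ω (DivO.vo InvO.acc)
/-- the second accumulator -/ local notation "𝔞₂" => ω (DivO.vo InvO.acc2)

/-- Stage 1, first half (`d1 := d + 1`, `d2 := 2 d`, the divisor copied and reversed); with
the second half: `RB := rev_d B mod x^d` (keeping `DB = B`), `m1 := d`. [folklore] -/
def divS1a : NCom S V O E :=
  setc (ρ (.iv .one)) 1 ;ₙ add (ρ .d1) (ρ .d) (ρ (.iv .one)) ;ₙ add (ρ .d2) (ρ .d) (ρ .d) ;ₙ
  teeN (ν .DB) 𝔞 𝔞₂ 𝔵 (ρ .d1) ;ₙ pour 𝔞 (ν .DB) ;ₙ pour 𝔞₂ (ν .T) ;ₙ revP (ν .T) (ν .T2) 𝔵 (ρ .d1)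

/-- Stage 1, second half. [folklore] -/
def divS1b : NCom S V O E :=
  moveN (ν .T2) 𝔞 𝔵 (ρ .d) ;ₙ pour 𝔞 (ν (.vv .RB)) ;ₙ clearV (ν .T2) ;ₙ mov (ρ (.iv .m1)) (ρ .d)

/-- Stage 1. [folklore] -/
def divS1 : NCom S V O E := divS1a ρ ν ω ;ₙ divS1b ρ ν ω

/-- Stage 2, first half (the dividend copied and reversed); with the second half:
`A-operand := rev_{2d-1} A mod x^d` (keeping `DA = A`), `B-operand := G`, `la := d`, `lb := d`.
[folklore] -/
def divS2a : NCom S V O E :=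
  teeN (ν .DA) 𝔞 𝔞₂ 𝔵 (ρ .d2) ;ₙ pour 𝔞 (ν .DA) ;ₙ pour 𝔞₂ (ν .T) ;ₙ revP (ν .T) (ν .T2) 𝔵 (ρ .d2)

/-- Stage 2, second half. [folklore] -/
def divS2b : NCom S V O E :=
  moveN (ν .T2) 𝔞 𝔵 (ρ .d) ;ₙ pour 𝔞 (ν (.vv (.pv .A))) ;ₙ clearV (ν .T2) ;ₙ
  moveN (ν (.vv .G)) 𝔞 𝔵 (ρ .d) ;ₙ pour 𝔞 (ν (.vv (.pv .B))) ;ₙ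
  mov (ρ (.iv (.pm .la))) (ρ .d) ;ₙ mov (ρ (.iv (.pm .lb))) (ρ .d)

/-- Stage 2. [folklore] -/
def divS2 : NCom S V O E := divS2a ρ ν ω ;ₙ divS2b ρ ν ω

/-- Stage 3, first half (`Q := rev (rev_n a · G mod x^d)`); with the second half:
`A-operand := Q`, `B-operand := B`, `la := d`, `lb := d + 1`. [folklore] -/
def divS3a : NCom S V O E :=
  moveN (ν (.vv (.pv .C))) 𝔞 𝔵 (ρ .d) ;ₙ clearV (ν (.vv (.pv .C))) ;ₙ pour 𝔞 (ν .T) ;ₙ revP (ν .T) (ν .Q) 𝔵 (ρ .d)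

/-- Stage 3, second half. [folklore] -/
def divS3b : NCom S V O E :=
  moveN (ν .Q) 𝔞 𝔵 (ρ .d) ;ₙ pour 𝔞 (ν (.vv (.pv .A))) ;ₙ moveN (ν .DB) 𝔞 𝔵 (ρ .d1) ;ₙ pour 𝔞 (ν (.vv (.pv .B))) ;ₙ
  mov (ρ (.iv (.pm .la))) (ρ .d) ;ₙ mov (ρ (.iv (.pm .lb))) (ρ .d1)

/-- Stage 3. [folklore] -/
def divS3 : NCom S V O E := divS3a ρ ν ω ;ₙ divS3b ρ ν ω

/-- Stage 4: the constants of the subtraction. [folklore] -/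
def divS4 : NCom S V O E :=
  setc (ρ (.iv (.ln .cu))) 1 ;ₙ setc (ρ (.iv (.ln .cv))) 1 ;ₙ mov (ρ (.iv (.ln .n))) (ρ (.iv (.pm .n))) ;ₙ mov (ρ (.iv (.ln .cnt))) (ρ .d)

/-- Stage 5: clean-up of the dividend's tail, the product and the reversed divisor. [folklore] -/
def divS5 : NCom S V O E := clearV (ν .DA) ;ₙ clearV (ν (.vv (.pv .C))) ;ₙ clearV (ν (.vv .RB))

/-- **Division with remainder** of `A` (`|A| = 2d`) by the monic `B` (`|B| = d + 1`): the
remainder `A mod B` (`d` coefficients) is appended to `accR`; `A`, `B` are consumed.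
[von zur Gathen–Gerhard 2013, Algorithm 9.5] [folklore] -/
def divP : NCom S V O E :=
  divS1 ρ ν ω ;ₙ (invP M ρi νi ωi ;ₙ (divS2 ρ ν ω ;ₙ (pmulP M ρq νq 𝔞 ;ₙ (divS3 ρ ν ω ;ₙ (pmulP M ρq νq 𝔞 ;ₙ
    (divS4 ρ ;ₙ (linP ρm (ν .DA) (ν (.vv (.pv .C))) (ω .accR) ;ₙ divS5 ν)))))))

omit [DecidableEq S] [DecidableEq V] [DecidableEq O] in
/-- The stages have no extension calls. [folklore] -/
theorem divS_noExt : (divS1 ρ ν ω : NCom S V O E).noExt ∧ (divS2 ρ ν ω : NCom S V O E).noExt ∧ (divS3 ρ ν ω : NCom S V O E).noExt ∧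
    (divS4 ρ : NCom S V O E).noExt ∧ (divS5 ν : NCom S V O E).noExt := by
  simp [divS1, divS1a, divS1b, divS2, divS2a, divS2b, divS3, divS3a, divS3b, divS4, divS5, noExt, teeN_noExt, moveN_noExt, revP_noExt]

set_option maxHeartbeats 10000000 in
set_option linter.unusedSimpArgs false in -- one uniform simp set drives the symbolic execution of every stage
/-- **Specification of `divP`** (von zur Gathen–Gerhard 2013, Algorithm 9.5 with Newton
inversion, Theorem 9.6): for `|A| = 2d`, `|B| = d + 1`, `B` monic with reduced entries, odd
`N > 1` and empty work queues, `accR` gains `coeffList N d (a mod b)`, `A` and `B` are consumed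
all work queues are empty again; `peak ≤ max peak (max 3N (8d + 2))`;
`steps ≤ steps + size d · (200 d + cost 4d + cost 6d + 101) + cost 4d + cost (4d + 2) + 400 d + 200`.
[folklore] -/
theorem divP_spec (σ : NState S V O) (A B : List ℕ) (d : ℕ) (hd : 1 ≤ d) (hN : 1 < σ.sc (ρ (.iv (.pm .n)))) (hodd : Odd (σ.sc (ρ (.iv (.pm .n)))))
    (hDA : σ.vi (ν .DA) = A) (hDB : σ.vi (ν .DB) = B) (hA : A.length = 2 * d) (hB : B.length = d + 1)
    (hAN : ∀ x ∈ A, x < σ.sc (ρ (.iv (.pm .n)))) (hBN : ∀ x ∈ B, x < σ.sc (ρ (.iv (.pm .n)))) (hlast : B.getLast? = some 1)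
    (hdreg : σ.sc (ρ .d) = d)
    (hT : σ.vi (ν .T) = []) (hT2 : σ.vi (ν .T2) = []) (hQ : σ.vi (ν .Q) = []) (hRB : σ.vi (ν (.vv .RB)) = []) (hG : σ.vi (ν (.vv .G)) = [])
    (hpA : σ.vi (ν (.vv (.pv .A))) = []) (hpB : σ.vi (ν (.vv (.pv .B))) = []) (hpF : σ.vi (ν (.vv (.pv .F))) = [])
    (hpG : σ.vi (ν (.vv (.pv .G))) = []) (hpH : σ.vi (ν (.vv (.pv .H))) = []) (hpC : σ.vi (ν (.vv (.pv .C))) = [])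
    (hacc : σ.vo (ω (.vo .acc)) = []) (hacc2 : σ.vo (ω (.vo .acc2)) = []) (haccL : σ.vo (ω (.vo .accL)) = []) :
    let τ := (divP M ρ ν ω : NCom S V O E).eval 𝓔 σ
    τ.vo (ω .accR) = σ.vo (ω .accR) ++ coeffList (σ.sc (ρ (.iv (.pm .n)))) d (listPoly (σ.sc (ρ (.iv (.pm .n)))) A %ₘ listPoly (σ.sc (ρ (.iv (.pm .n)))) B) ∧
      τ.vi (ν .DA) = [] ∧ τ.vi (ν .DB) = [] ∧ τ.vi (ν .T) = [] ∧ τ.vi (ν .T2) = [] ∧ τ.vi (ν .Q) = [] ∧ τ.vi (ν (.vv .RB)) = [] ∧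
      τ.vi (ν (.vv .G)) = [] ∧ τ.vi (ν (.vv (.pv .A))) = [] ∧ τ.vi (ν (.vv (.pv .B))) = [] ∧ τ.vi (ν (.vv (.pv .F))) = [] ∧
      τ.vi (ν (.vv (.pv .G))) = [] ∧ τ.vi (ν (.vv (.pv .H))) = [] ∧ τ.vi (ν (.vv (.pv .C))) = [] ∧
      τ.vo (ω (.vo .acc)) = [] ∧ τ.vo (ω (.vo .acc2)) = [] ∧ τ.vo (ω (.vo .accL)) = [] ∧
      (∀ w, (∀ i, w ≠ ν i) → τ.vi w = σ.vi w) ∧ (∀ p, (∀ i, p ≠ ω i) → τ.vo p = σ.vo p) ∧ (∀ r, (∀ i, r ≠ ρ i) → τ.sc r = σ.sc r) ∧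
      τ.sc (ρ .d) = d ∧ τ.sc (ρ (.iv (.pm .n))) = σ.sc (ρ (.iv (.pm .n))) ∧
      τ.peak ≤ max σ.peak (max (3 * σ.sc (ρ (.iv (.pm .n)))) (8 * d + 2)) ∧
      τ.steps ≤ σ.steps + d.size * (200 * d + M.cost (4 * d) + M.cost (6 * d) + 101) + M.cost (4 * d) + M.cost (4 * d + 2) + 400 * d + 200 ∧
      (divP M ρ ν ω : NCom S V O E).extOK 𝓔 σ := by
  intro τ
  have ho : ω (.vo .acc) ≠ ω (.vo .acc2) := by simp
  have hTT2 : ν .T ≠ ν .T2 := by simp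
  have hTQ : ν .T ≠ ν .Q := by simp
  have hA' : A.length = d + d := by omega
  have htB : B.take (d + 1) = B := List.take_of_length_le (by omega)
  have hdB : B.drop (d + 1) = [] := List.drop_of_length_le (by omega)
  have htA : A.take (d + d) = A := List.take_of_length_le (by omega)
  have hdA : A.drop (d + d) = [] := List.drop_of_length_le (by omega)
  have hRBl : ((B.reverse).take d).length = d := by rw [List.length_take, List.length_reverse]; omega
  have hRBN : ∀ x ∈ (B.reverse).take d, x < σ.sc (ρ (.iv (.pm .n))) := fun x hx => hBN x (List.mem_reverse.1 (List.mem_of_mem_take hx))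
  have hRAN : ∀ x ∈ (A.reverse).take d, x < σ.sc (ρ (.iv (.pm .n))) := fun x hx => hAN x (List.mem_reverse.1 (List.mem_of_mem_take hx))
  have hh0 : ((B.reverse).take d).head? = some 1 := by
    rw [List.head?_take, if_neg (by omega), List.head?_reverse]; exact hlast
  obtain ⟨G, hGdef⟩ : ∃ G, G = newtonInv (σ.sc (ρ (.iv (.pm .n)))) ((B.reverse).take d) := ⟨_, rfl⟩
  have hGl : G.length = d := by rw [hGdef, length_newtonInv _ (by omega), hRBl]
  have htG : G.take d = G := List.take_of_length_le (by omega)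
  have hdG : G.drop d = [] := List.drop_of_length_le (by omega)
  obtain ⟨RA, hRA⟩ : ∃ RA, RA = (A.reverse).take d := ⟨_, rfl⟩
  have hRAl : RA.length = d := by rw [hRA, List.length_take, List.length_reverse]; omega
  obtain ⟨C1, hC1⟩ : ∃ C1, C1 = mulCoeffs (σ.sc (ρ (.iv (.pm .n)))) RA G := ⟨_, rfl⟩
  have hC1l : C1.length = d + d - 1 := by rw [hC1, length_mulCoeffs, hRAl, hGl]
  have hC1d : d ≤ C1.length := by omega
  have hC1t : (C1.take d).length = d := by rw [List.length_take]; omega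
  have hdt : (C1.take d).drop d = [] := List.drop_of_length_le (by omega)
  obtain ⟨Ql, hQl⟩ : ∃ Ql, Ql = (C1.take d).reverse := ⟨_, rfl⟩
  have hQll : Ql.length = d := by rw [hQl, List.length_reverse, hC1t]
  have htQ : Ql.take d = Ql := List.take_of_length_le (by omega)
  have hdQ : Ql.drop d = [] := List.drop_of_length_le (by omega)
  obtain ⟨C2, hC2⟩ : ∃ C2, C2 = mulCoeffs (σ.sc (ρ (.iv (.pm .n)))) Ql B := ⟨_, rfl⟩
  have hC2l : C2.length = d + d := by rw [hC2, length_mulCoeffs, hQll, hB]; omega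
  have hC2d : d ≤ C2.length := by omega
  -- the stage states, made opaque
  set X1a := (divS1a ρ ν ω : NCom S V O E).eval 𝓔 σ with hX1a
  set X1 := (divS1b ρ ν ω : NCom S V O E).eval 𝓔 X1a with hX1
  have hX1' : X1 = (divS1 ρ ν ω : NCom S V O E).eval 𝓔 σ := rfl
  set Y1 := (invP M ρi νi ωi : NCom S V O E).eval 𝓔 X1 with hY1
  set X2a := (divS2a ρ ν ω : NCom S V O E).eval 𝓔 Y1 with hX2a
  set X2 := (divS2b ρ ν ω : NCom S V O E).eval 𝓔 X2a with hX2
  have hX2' : X2 = (divS2 ρ ν ω : NCom S V O E).eval 𝓔 Y1 := rfl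
  set Y2 := (pmulP M ρq νq (ω (.vo .acc)) : NCom S V O E).eval 𝓔 X2 with hY2
  set X3a := (divS3a ρ ν ω : NCom S V O E).eval 𝓔 Y2 with hX3a
  set X3 := (divS3b ρ ν ω : NCom S V O E).eval 𝓔 X3a with hX3
  have hX3' : X3 = (divS3 ρ ν ω : NCom S V O E).eval 𝓔 Y2 := rfl
  set Y3 := (pmulP M ρq νq (ω (.vo .acc)) : NCom S V O E).eval 𝓔 X3 with hY3
  set X4 := (divS4 ρ : NCom S V O E).eval 𝓔 Y3 with hX4
  have hτ : τ = (divS5 ν : NCom S V O E).eval 𝓔 ((linP (InvS.lnE.trans (DivS.ivE.trans ρ)) (ν .DA) (ν (.vv (.pv .C))) (ω .accR) : NCom S V O E).eval 𝓔 X4) := rfl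
  clear_value X1a X1 Y1 X2a X2 Y2 X3a X3 Y3 X4 τ
  -- stage 1
  have nX1a := hX1a
  simp only [hDA, hDB, hT, hT2, hQ, hRB, hG, hpA, hpB, hpF, hpG, hpH, hpC, hacc, hacc2, haccL, hdreg, ← hGdef, ← hRA, ← hC1, ← hQl, ← hC2, hA', hB, htB, hdB, htA, hdA, hRBl, hGl, htG, hdG, hRAl, hC1d, hC1t, hdt, hQll, htQ, hdQ, hC2l, hC2d, divS1, divS1a, divS1b, divS2, divS2a, divS2b, divS3, divS3a, divS3b, divS4, divS5, eval_seq, eval, teeN_eq 𝓔 _ ho, moveN_eq' 𝓔, revP_eq 𝓔 hTT2, revP_eq 𝓔 hTQ,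
      NState.sc_bump, NState.sc_setSc, NState.sc_setVi, NState.sc_setVo, NState.vi_bump,
      NState.vi_setSc, NState.vi_setVi, NState.vi_setVo, NState.vo_bump, NState.vo_setSc, NState.vo_setVi, NState.vo_setVo,
      NState.steps_bump, NState.steps_setSc, NState.steps_setVi, NState.steps_setVo, NState.peak_bump, NState.peak_setSc, NState.peak_setVi,
      NState.peak_setVo, Function.update_apply, EmbeddingLike.apply_eq_iff_eq, reduceCtorEq, DivV.vv.injEq, DivS.iv.injEq, DivO.vo.injEq,
      InvV.pv.injEq, InvS.pm.injEq, InvS.ln.injEq,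
      ite_true, ite_false, not_false_eq_true, implies_true, Nat.max_zero, Nat.zero_max, Nat.le_add_right,
      List.take_length, List.drop_length, List.nil_append, List.append_nil, le_refl, List.take_append_drop, List.length_nil, List.length_append,
      List.length_reverse, List.length_take, length_mulCoeffs, List.take_take, Nat.min_self] at nX1a
  obtain ⟨aaDA, aaDB, aaT, aaT2, aaQ, aaRB, aaG, aapA, aapB, aapF, aapG, aapH, aapC, aaacc, aaacc2, aaaccL, aaaccR, aad, aad1, aad2, aaone, aan⟩ :
      X1a.vi (ν .DA) = A ∧
      X1a.vi (ν .DB) = B ∧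
      X1a.vi (ν .T) = [] ∧
      X1a.vi (ν .T2) = B.reverse ∧
      X1a.vi (ν .Q) = [] ∧
      X1a.vi (ν (.vv .RB)) = [] ∧
      X1a.vi (ν (.vv .G)) = [] ∧
      X1a.vi (ν (.vv (.pv .A))) = [] ∧
      X1a.vi (ν (.vv (.pv .B))) = [] ∧
      X1a.vi (ν (.vv (.pv .F))) = [] ∧
      X1a.vi (ν (.vv (.pv .G))) = [] ∧
      X1a.vi (ν (.vv (.pv .H))) = [] ∧
      X1a.vi (ν (.vv (.pv .C))) = [] ∧
      X1a.vo (ω (.vo .acc)) = [] ∧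
      X1a.vo (ω (.vo .acc2)) = [] ∧
      X1a.vo (ω (.vo .accL)) = [] ∧
      X1a.vo (ω .accR) = σ.vo (ω .accR) ∧
      X1a.sc (ρ .d) = d ∧
      X1a.sc (ρ .d1) = d + 1 ∧
      X1a.sc (ρ .d2) = d + d ∧
      X1a.sc (ρ (.iv .one)) = 1 ∧
      X1a.sc (ρ (.iv (.pm .n))) = σ.sc (ρ (.iv (.pm .n))) := by
    rw [nX1a]; simp only [hDA, hDB, hT, hT2, hQ, hRB, hG, hpA, hpB, hpF, hpG, hpH, hpC, hacc, hacc2, haccL, hdreg, ← hGdef, ← hRA, ← hC1, ← hQl, ← hC2, hA', hB, htB, hdB, htA, hdA, hRBl, hGl, htG, hdG, hRAl, hC1d, hC1t, hdt, hQll, htQ, hdQ, hC2l, hC2d, NState.sc_bump, NState.sc_setSc, NState.sc_setVi, NState.sc_setVo, NState.vi_bump,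
      NState.vi_setSc, NState.vi_setVi, NState.vi_setVo, NState.vo_bump, NState.vo_setSc, NState.vo_setVi, NState.vo_setVo,
      NState.steps_bump, NState.steps_setSc, NState.steps_setVi, NState.steps_setVo, NState.peak_bump, NState.peak_setSc, NState.peak_setVi,
      NState.peak_setVo, Function.update_apply, EmbeddingLike.apply_eq_iff_eq, reduceCtorEq, DivV.vv.injEq, DivS.iv.injEq, DivO.vo.injEq,
      InvV.pv.injEq, InvS.pm.injEq, InvS.ln.injEq,
      ite_true, ite_false, not_false_eq_true, implies_true, Nat.max_zero, Nat.zero_max, Nat.le_add_right,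
      List.take_length, List.drop_length, List.nil_append, List.append_nil, le_refl, List.take_append_drop, List.length_nil, List.length_append,
      List.length_reverse, List.length_take, length_mulCoeffs, List.take_take, Nat.min_self, and_self, and_true, true_and]
  have aapk : X1a.peak = max (max (max σ.peak 1) (d + 1)) (d + d) := by
    rw [nX1a]; try simp only [hDA, hDB, hT, hT2, hQ, hRB, hG, hpA, hpB, hpF, hpG, hpH, hpC, hacc, hacc2, haccL, hdreg, ← hGdef, ← hRA, ← hC1, ← hQl, ← hC2, hA', hB, htB, hdB, htA, hdA, hRBl, hGl, htG, hdG, hRAl, hC1d, hC1t, hdt, hQll, htQ, hdQ, hC2l, hC2d, NState.sc_bump, NState.sc_setSc, NState.sc_setVi, NState.sc_setVo, NState.vi_bump,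
      NState.vi_setSc, NState.vi_setVi, NState.vi_setVo, NState.vo_bump, NState.vo_setSc, NState.vo_setVi, NState.vo_setVo,
      NState.steps_bump, NState.steps_setSc, NState.steps_setVi, NState.steps_setVo, NState.peak_bump, NState.peak_setSc, NState.peak_setVi,
      NState.peak_setVo, Function.update_apply, EmbeddingLike.apply_eq_iff_eq, reduceCtorEq, DivV.vv.injEq, DivS.iv.injEq, DivO.vo.injEq,
      InvV.pv.injEq, InvS.pm.injEq, InvS.ln.injEq,
      ite_true, ite_false, not_false_eq_true, implies_true, Nat.max_zero, Nat.zero_max, Nat.le_add_right,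
      List.take_length, List.drop_length, List.nil_append, List.append_nil, le_refl, List.take_append_drop, List.length_nil, List.length_append,
      List.length_reverse, List.length_take, length_mulCoeffs, List.take_take, Nat.min_self]
  have aast : X1a.steps ≤ σ.steps + 12 * d + 16 := by
    rw [nX1a]; simp only [hDA, hDB, hT, hT2, hQ, hRB, hG, hpA, hpB, hpF, hpG, hpH, hpC, hacc, hacc2, haccL, hdreg, ← hGdef, ← hRA, ← hC1, ← hQl, ← hC2, hA', hB, htB, hdB, htA, hdA, hRBl, hGl, htG, hdG, hRAl, hC1d, hC1t, hdt, hQll, htQ, hdQ, hC2l, hC2d, NState.sc_bump, NState.sc_setSc, NState.sc_setVi, NState.sc_setVo, NState.vi_bump,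
      NState.vi_setSc, NState.vi_setVi, NState.vi_setVo, NState.vo_bump, NState.vo_setSc, NState.vo_setVi, NState.vo_setVo,
      NState.steps_bump, NState.steps_setSc, NState.steps_setVi, NState.steps_setVo, NState.peak_bump, NState.peak_setSc, NState.peak_setVi,
      NState.peak_setVo, Function.update_apply, EmbeddingLike.apply_eq_iff_eq, reduceCtorEq, DivV.vv.injEq, DivS.iv.injEq, DivO.vo.injEq,
      InvV.pv.injEq, InvS.pm.injEq, InvS.ln.injEq,
      ite_true, ite_false, not_false_eq_true, implies_true, Nat.max_zero, Nat.zero_max, Nat.le_add_right,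
      List.take_length, List.drop_length, List.nil_append, List.append_nil, le_refl, List.take_append_drop, List.length_nil, List.length_append,
      List.length_reverse, List.length_take, length_mulCoeffs, List.take_take, Nat.min_self]
    clear * - hd; omega
  have aa_w : ∀ w, (∀ i, w ≠ ν i) → X1a.vi w = σ.vi w := fun w hw => by rw [nX1a]; simp only [hw, hDA, hDB, hT, hT2, hQ, hRB, hG, hpA, hpB, hpF, hpG, hpH, hpC, hacc, hacc2, haccL, hdreg, ← hGdef, ← hRA, ← hC1, ← hQl, ← hC2, hA', hB, htB, hdB, htA, hdA, hRBl, hGl, htG, hdG, hRAl, hC1d, hC1t, hdt, hQll, htQ, hdQ, hC2l, hC2d, NState.sc_bump, NState.sc_setSc, NState.sc_setVi, NState.sc_setVo, NState.vi_bump,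
      NState.vi_setSc, NState.vi_setVi, NState.vi_setVo, NState.vo_bump, NState.vo_setSc, NState.vo_setVi, NState.vo_setVo,
      NState.steps_bump, NState.steps_setSc, NState.steps_setVi, NState.steps_setVo, NState.peak_bump, NState.peak_setSc, NState.peak_setVi,
      NState.peak_setVo, Function.update_apply, EmbeddingLike.apply_eq_iff_eq, reduceCtorEq, DivV.vv.injEq, DivS.iv.injEq, DivO.vo.injEq,
      InvV.pv.injEq, InvS.pm.injEq, InvS.ln.injEq,
      ite_true, ite_false, not_false_eq_true, implies_true, Nat.max_zero, Nat.zero_max, Nat.le_add_right,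
      List.take_length, List.drop_length, List.nil_append, List.append_nil, le_refl, List.take_append_drop, List.length_nil, List.length_append,
      List.length_reverse, List.length_take, length_mulCoeffs, List.take_take, Nat.min_self]
  have aa_p : ∀ p, (∀ i, p ≠ ω i) → X1a.vo p = σ.vo p := fun p hp => by rw [nX1a]; simp only [hp, hDA, hDB, hT, hT2, hQ, hRB, hG, hpA, hpB, hpF, hpG, hpH, hpC, hacc, hacc2, haccL, hdreg, ← hGdef, ← hRA, ← hC1, ← hQl, ← hC2, hA', hB, htB, hdB, htA, hdA, hRBl, hGl, htG, hdG, hRAl, hC1d, hC1t, hdt, hQll, htQ, hdQ, hC2l, hC2d, NState.sc_bump, NState.sc_setSc, NState.sc_setVi, NState.sc_setVo, NState.vi_bump,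
      NState.vi_setSc, NState.vi_setVi, NState.vi_setVo, NState.vo_bump, NState.vo_setSc, NState.vo_setVi, NState.vo_setVo,
      NState.steps_bump, NState.steps_setSc, NState.steps_setVi, NState.steps_setVo, NState.peak_bump, NState.peak_setSc, NState.peak_setVi,
      NState.peak_setVo, Function.update_apply, EmbeddingLike.apply_eq_iff_eq, reduceCtorEq, DivV.vv.injEq, DivS.iv.injEq, DivO.vo.injEq,
      InvV.pv.injEq, InvS.pm.injEq, InvS.ln.injEq,
      ite_true, ite_false, not_false_eq_true, implies_true, Nat.max_zero, Nat.zero_max, Nat.le_add_right,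
      List.take_length, List.drop_length, List.nil_append, List.append_nil, le_refl, List.take_append_drop, List.length_nil, List.length_append,
      List.length_reverse, List.length_take, length_mulCoeffs, List.take_take, Nat.min_self]
  have aa_r : ∀ r, (∀ i, r ≠ ρ i) → X1a.sc r = σ.sc r := fun r hr => by rw [nX1a]; simp only [hr, hDA, hDB, hT, hT2, hQ, hRB, hG, hpA, hpB, hpF, hpG, hpH, hpC, hacc, hacc2, haccL, hdreg, ← hGdef, ← hRA, ← hC1, ← hQl, ← hC2, hA', hB, htB, hdB, htA, hdA, hRBl, hGl, htG, hdG, hRAl, hC1d, hC1t, hdt, hQll, htQ, hdQ, hC2l, hC2d, NState.sc_bump, NState.sc_setSc, NState.sc_setVi, NState.sc_setVo, NState.vi_bump,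
      NState.vi_setSc, NState.vi_setVi, NState.vi_setVo, NState.vo_bump, NState.vo_setSc, NState.vo_setVi, NState.vo_setVo,
      NState.steps_bump, NState.steps_setSc, NState.steps_setVi, NState.steps_setVo, NState.peak_bump, NState.peak_setSc, NState.peak_setVi,
      NState.peak_setVo, Function.update_apply, EmbeddingLike.apply_eq_iff_eq, reduceCtorEq, DivV.vv.injEq, DivS.iv.injEq, DivO.vo.injEq,
      InvV.pv.injEq, InvS.pm.injEq, InvS.ln.injEq,
      ite_true, ite_false, not_false_eq_true, implies_true, Nat.max_zero, Nat.zero_max, Nat.le_add_right,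
      List.take_length, List.drop_length, List.nil_append, List.append_nil, le_refl, List.take_append_drop, List.length_nil, List.length_append,
      List.length_reverse, List.length_take, length_mulCoeffs, List.take_take, Nat.min_self]
  clear nX1a
  have nX1 := hX1
  simp only [aaDA, aaDB, aaT, aaT2, aaQ, aaRB, aaG, aapA, aapB, aapF, aapG, aapH, aapC, aaacc, aaacc2, aaaccL, aaaccR, aad, aad1, aad2, aaone, aan, ← hGdef, ← hRA, ← hC1, ← hQl, ← hC2, hA', hB, htB, hdB, htA, hdA, hRBl, hGl, htG, hdG, hRAl, hC1d, hC1t, hdt, hQll, htQ, hdQ, hC2l, hC2d, divS1, divS1a, divS1b, divS2, divS2a, divS2b, divS3, divS3a, divS3b, divS4, divS5, eval_seq, eval, teeN_eq 𝓔 _ ho, moveN_eq' 𝓔, revP_eq 𝓔 hTT2, revP_eq 𝓔 hTQ,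
      NState.sc_bump, NState.sc_setSc, NState.sc_setVi, NState.sc_setVo, NState.vi_bump,
      NState.vi_setSc, NState.vi_setVi, NState.vi_setVo, NState.vo_bump, NState.vo_setSc, NState.vo_setVi, NState.vo_setVo,
      NState.steps_bump, NState.steps_setSc, NState.steps_setVi, NState.steps_setVo, NState.peak_bump, NState.peak_setSc, NState.peak_setVi,
      NState.peak_setVo, Function.update_apply, EmbeddingLike.apply_eq_iff_eq, reduceCtorEq, DivV.vv.injEq, DivS.iv.injEq, DivO.vo.injEq,
      InvV.pv.injEq, InvS.pm.injEq, InvS.ln.injEq,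
      ite_true, ite_false, not_false_eq_true, implies_true, Nat.max_zero, Nat.zero_max, Nat.le_add_right,
      List.take_length, List.drop_length, List.nil_append, List.append_nil, le_refl, List.take_append_drop, List.length_nil, List.length_append,
      List.length_reverse, List.length_take, length_mulCoeffs, List.take_take, Nat.min_self] at nX1
  obtain ⟨aDA, aDB, aT, aT2, aQ, aRB, aG, apA, apB, apF, apG, apH, apC, aacc, aacc2, aaccL, aaccR, ad, ad1, ad2, aone, am1, an⟩ :
      X1.vi (ν .DA) = A ∧
      X1.vi (ν .DB) = B ∧
      X1.vi (ν .T) = [] ∧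
      X1.vi (ν .T2) = [] ∧
      X1.vi (ν .Q) = [] ∧
      X1.vi (ν (.vv .RB)) = (B.reverse).take d ∧
      X1.vi (ν (.vv .G)) = [] ∧
      X1.vi (ν (.vv (.pv .A))) = [] ∧
      X1.vi (ν (.vv (.pv .B))) = [] ∧
      X1.vi (ν (.vv (.pv .F))) = [] ∧
      X1.vi (ν (.vv (.pv .G))) = [] ∧
      X1.vi (ν (.vv (.pv .H))) = [] ∧
      X1.vi (ν (.vv (.pv .C))) = [] ∧
      X1.vo (ω (.vo .acc)) = [] ∧
      X1.vo (ω (.vo .acc2)) = [] ∧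
      X1.vo (ω (.vo .accL)) = [] ∧
      X1.vo (ω .accR) = σ.vo (ω .accR) ∧
      X1.sc (ρ .d) = d ∧
      X1.sc (ρ .d1) = d + 1 ∧
      X1.sc (ρ .d2) = d + d ∧
      X1.sc (ρ (.iv .one)) = 1 ∧
      X1.sc (ρ (.iv .m1)) = d ∧
      X1.sc (ρ (.iv (.pm .n))) = σ.sc (ρ (.iv (.pm .n))) := by
    rw [nX1]; simp only [aaDA, aaDB, aaT, aaT2, aaQ, aaRB, aaG, aapA, aapB, aapF, aapG, aapH, aapC, aaacc, aaacc2, aaaccL, aaaccR, aad, aad1, aad2, aaone, aan, ← hGdef, ← hRA, ← hC1, ← hQl, ← hC2, hA', hB, htB, hdB, htA, hdA, hRBl, hGl, htG, hdG, hRAl, hC1d, hC1t, hdt, hQll, htQ, hdQ, hC2l, hC2d, NState.sc_bump, NState.sc_setSc, NState.sc_setVi, NState.sc_setVo, NState.vi_bump,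
      NState.vi_setSc, NState.vi_setVi, NState.vi_setVo, NState.vo_bump, NState.vo_setSc, NState.vo_setVi, NState.vo_setVo,
      NState.steps_bump, NState.steps_setSc, NState.steps_setVi, NState.steps_setVo, NState.peak_bump, NState.peak_setSc, NState.peak_setVi,
      NState.peak_setVo, Function.update_apply, EmbeddingLike.apply_eq_iff_eq, reduceCtorEq, DivV.vv.injEq, DivS.iv.injEq, DivO.vo.injEq,
      InvV.pv.injEq, InvS.pm.injEq, InvS.ln.injEq,
      ite_true, ite_false, not_false_eq_true, implies_true, Nat.max_zero, Nat.zero_max, Nat.le_add_right,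
      List.take_length, List.drop_length, List.nil_append, List.append_nil, le_refl, List.take_append_drop, List.length_nil, List.length_append,
      List.length_reverse, List.length_take, length_mulCoeffs, List.take_take, Nat.min_self, and_self, and_true, true_and]
  have apk : X1.peak = max (max (max σ.peak 1) (d + 1)) (d + d) := by
    rw [nX1]; try simp only [aapk, aaDA, aaDB, aaT, aaT2, aaQ, aaRB, aaG, aapA, aapB, aapF, aapG, aapH, aapC, aaacc, aaacc2, aaaccL, aaaccR, aad, aad1, aad2, aaone, aan, ← hGdef, ← hRA, ← hC1, ← hQl, ← hC2, hA', hB, htB, hdB, htA, hdA, hRBl, hGl, htG, hdG, hRAl, hC1d, hC1t, hdt, hQll, htQ, hdQ, hC2l, hC2d, NState.sc_bump, NState.sc_setSc, NState.sc_setVi, NState.sc_setVo, NState.vi_bump,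
      NState.vi_setSc, NState.vi_setVi, NState.vi_setVo, NState.vo_bump, NState.vo_setSc, NState.vo_setVi, NState.vo_setVo,
      NState.steps_bump, NState.steps_setSc, NState.steps_setVi, NState.steps_setVo, NState.peak_bump, NState.peak_setSc, NState.peak_setVi,
      NState.peak_setVo, Function.update_apply, EmbeddingLike.apply_eq_iff_eq, reduceCtorEq, DivV.vv.injEq, DivS.iv.injEq, DivO.vo.injEq,
      InvV.pv.injEq, InvS.pm.injEq, InvS.ln.injEq,
      ite_true, ite_false, not_false_eq_true, implies_true, Nat.max_zero, Nat.zero_max, Nat.le_add_right,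
      List.take_length, List.drop_length, List.nil_append, List.append_nil, le_refl, List.take_append_drop, List.length_nil, List.length_append,
      List.length_reverse, List.length_take, length_mulCoeffs, List.take_take, Nat.min_self]
  have ast : X1.steps ≤ σ.steps + 20 * d + 20 := by
    rw [nX1]; simp only [aaDA, aaDB, aaT, aaT2, aaQ, aaRB, aaG, aapA, aapB, aapF, aapG, aapH, aapC, aaacc, aaacc2, aaaccL, aaaccR, aad, aad1, aad2, aaone, aan, ← hGdef, ← hRA, ← hC1, ← hQl, ← hC2, hA', hB, htB, hdB, htA, hdA, hRBl, hGl, htG, hdG, hRAl, hC1d, hC1t, hdt, hQll, htQ, hdQ, hC2l, hC2d, NState.sc_bump, NState.sc_setSc, NState.sc_setVi, NState.sc_setVo, NState.vi_bump,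
      NState.vi_setSc, NState.vi_setVi, NState.vi_setVo, NState.vo_bump, NState.vo_setSc, NState.vo_setVi, NState.vo_setVo,
      NState.steps_bump, NState.steps_setSc, NState.steps_setVi, NState.steps_setVo, NState.peak_bump, NState.peak_setSc, NState.peak_setVi,
      NState.peak_setVo, Function.update_apply, EmbeddingLike.apply_eq_iff_eq, reduceCtorEq, DivV.vv.injEq, DivS.iv.injEq, DivO.vo.injEq,
      InvV.pv.injEq, InvS.pm.injEq, InvS.ln.injEq,
      ite_true, ite_false, not_false_eq_true, implies_true, Nat.max_zero, Nat.zero_max, Nat.le_add_right,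
      List.take_length, List.drop_length, List.nil_append, List.append_nil, le_refl, List.take_append_drop, List.length_nil, List.length_append,
      List.length_reverse, List.length_take, length_mulCoeffs, List.take_take, Nat.min_self]
    (try simp only [List.length_drop, List.length_reverse, hB]); clear * - hd aast; omega
  have a_w : ∀ w, (∀ i, w ≠ ν i) → X1.vi w = σ.vi w := fun w hw => by
    rw [← aa_w w hw, nX1]; simp only [hw, aaDA, aaDB, aaT, aaT2, aaQ, aaRB, aaG, aapA, aapB, aapF, aapG, aapH, aapC, aaacc, aaacc2, aaaccL, aaaccR, aad, aad1, aad2, aaone, aan, ← hGdef, ← hRA, ← hC1, ← hQl, ← hC2, hA', hB, htB, hdB, htA, hdA, hRBl, hGl, htG, hdG, hRAl, hC1d, hC1t, hdt, hQll, htQ, hdQ, hC2l, hC2d, NState.sc_bump, NState.sc_setSc, NState.sc_setVi, NState.sc_setVo, NState.vi_bump,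
      NState.vi_setSc, NState.vi_setVi, NState.vi_setVo, NState.vo_bump, NState.vo_setSc, NState.vo_setVi, NState.vo_setVo,
      NState.steps_bump, NState.steps_setSc, NState.steps_setVi, NState.steps_setVo, NState.peak_bump, NState.peak_setSc, NState.peak_setVi,
      NState.peak_setVo, Function.update_apply, EmbeddingLike.apply_eq_iff_eq, reduceCtorEq, DivV.vv.injEq, DivS.iv.injEq, DivO.vo.injEq,
      InvV.pv.injEq, InvS.pm.injEq, InvS.ln.injEq,
      ite_true, ite_false, not_false_eq_true, implies_true, Nat.max_zero, Nat.zero_max, Nat.le_add_right,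
      List.take_length, List.drop_length, List.nil_append, List.append_nil, le_refl, List.take_append_drop, List.length_nil, List.length_append,
      List.length_reverse, List.length_take, length_mulCoeffs, List.take_take, Nat.min_self]
  have a_p : ∀ p, (∀ i, p ≠ ω i) → X1.vo p = σ.vo p := fun p hp => by
    rw [← aa_p p hp, nX1]; simp only [hp, aaDA, aaDB, aaT, aaT2, aaQ, aaRB, aaG, aapA, aapB, aapF, aapG, aapH, aapC, aaacc, aaacc2, aaaccL, aaaccR, aad, aad1, aad2, aaone, aan, ← hGdef, ← hRA, ← hC1, ← hQl, ← hC2, hA', hB, htB, hdB, htA, hdA, hRBl, hGl, htG, hdG, hRAl, hC1d, hC1t, hdt, hQll, htQ, hdQ, hC2l, hC2d, NState.sc_bump, NState.sc_setSc, NState.sc_setVi, NState.sc_setVo, NState.vi_bump,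
      NState.vi_setSc, NState.vi_setVi, NState.vi_setVo, NState.vo_bump, NState.vo_setSc, NState.vo_setVi, NState.vo_setVo,
      NState.steps_bump, NState.steps_setSc, NState.steps_setVi, NState.steps_setVo, NState.peak_bump, NState.peak_setSc, NState.peak_setVi,
      NState.peak_setVo, Function.update_apply, EmbeddingLike.apply_eq_iff_eq, reduceCtorEq, DivV.vv.injEq, DivS.iv.injEq, DivO.vo.injEq,
      InvV.pv.injEq, InvS.pm.injEq, InvS.ln.injEq,
      ite_true, ite_false, not_false_eq_true, implies_true, Nat.max_zero, Nat.zero_max, Nat.le_add_right,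
      List.take_length, List.drop_length, List.nil_append, List.append_nil, le_refl, List.take_append_drop, List.length_nil, List.length_append,
      List.length_reverse, List.length_take, length_mulCoeffs, List.take_take, Nat.min_self]
  have a_r : ∀ r, (∀ i, r ≠ ρ i) → X1.sc r = σ.sc r := fun r hr => by
    rw [← aa_r r hr, nX1]; simp only [hr, aaDA, aaDB, aaT, aaT2, aaQ, aaRB, aaG, aapA, aapB, aapF, aapG, aapH, aapC, aaacc, aaacc2, aaaccL, aaaccR, aad, aad1, aad2, aaone, aan, ← hGdef, ← hRA, ← hC1, ← hQl, ← hC2, hA', hB, htB, hdB, htA, hdA, hRBl, hGl, htG, hdG, hRAl, hC1d, hC1t, hdt, hQll, htQ, hdQ, hC2l, hC2d, NState.sc_bump, NState.sc_setSc, NState.sc_setVi, NState.sc_setVo, NState.vi_bump,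
      NState.vi_setSc, NState.vi_setVi, NState.vi_setVo, NState.vo_bump, NState.vo_setSc, NState.vo_setVi, NState.vo_setVo,
      NState.steps_bump, NState.steps_setSc, NState.steps_setVi, NState.steps_setVo, NState.peak_bump, NState.peak_setSc, NState.peak_setVi,
      NState.peak_setVo, Function.update_apply, EmbeddingLike.apply_eq_iff_eq, reduceCtorEq, DivV.vv.injEq, DivS.iv.injEq, DivO.vo.injEq,
      InvV.pv.injEq, InvS.pm.injEq, InvS.ln.injEq,
      ite_true, ite_false, not_false_eq_true, implies_true, Nat.max_zero, Nat.zero_max, Nat.le_add_right,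
      List.take_length, List.drop_length, List.nil_append, List.append_nil, le_refl, List.take_append_drop, List.length_nil, List.length_append,
      List.length_reverse, List.length_take, length_mulCoeffs, List.take_take, Nat.min_self]
  clear nX1
  -- the inversion
  obtain ⟨i1, i2, i3, i4, i5, i6, i7, i8, i9, i10, i11, i12, i13, i14, i15, i16, i17, i18, i19, i20, i21⟩ :=
    invP_spec M (DivS.ivE.trans ρ) (DivV.vvE.trans ν) (DivO.voE.trans ω) X1 ((B.reverse).take d)
      (by show 1 < X1.sc (ρ (.iv (.pm .n))); rw [an]; exact hN) (by show Odd (X1.sc (ρ (.iv (.pm .n)))); rw [an]; exact hodd)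
      aRB (by show X1.sc (ρ (.iv .m1)) = _; rw [am1, hRBl]) (by rw [hRBl]; exact hd)
      (by show ∀ x ∈ (B.reverse).take d, x < X1.sc (ρ (.iv (.pm .n))); rw [an]; exact hRBN) hh0 apA apB apF apG apH apC aacc aacc2 aaccL
  rw [← hY1] at i1 i4 i5 i6 i7 i8 i9 i10 i11 i12 i13 i14 i15 i16 i17 i18 i19 i20
  simp only [Function.Embedding.trans_apply, DivS.ivE_apply, DivV.vvE_apply, DivO.voE_apply, InvS.pmE_apply, InvV.pvE_apply, InvS.lnE_apply] at i1 i2 i3 i4 i5 i6 i7 i8 i9 i10 i11 i12 i13 i14 i15 i16 i17 i18 i19 i20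
  rw [show X1.sc ((DivS.ivE.trans ρ) (InvS.pm PMulS.n)) = σ.sc (ρ (.iv (.pm .n))) from an] at i3
  rw [an] at i1 i2 i3 i19
  rw [← hGdef] at i1 i2 i3
  rw [hRBl] at i3 i18 i19 i20
  have yv : ∀ w : DivV, (∀ i, w ≠ .vv i) → Y1.vi (ν w) = X1.vi (ν w) := fun w hw => i14 _ (fun i => by simpa using hw i)
  have yo : ∀ p : DivO, (∀ i, p ≠ .vo i) → Y1.vo (ω p) = X1.vo (ω p) := fun p hp => i15 _ (fun i => by simpa using hp i)
  have ys : ∀ r : DivS, (∀ i, r ≠ .iv i) → Y1.sc (ρ r) = X1.sc (ρ r) := fun r hr => i16 _ (fun i => by simpa using hr i)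
  have yDA : Y1.vi (ν .DA) = A := (yv .DA (by simp)).trans aDA
  have yDB : Y1.vi (ν .DB) = B := (yv .DB (by simp)).trans aDB
  have yT : Y1.vi (ν .T) = [] := (yv .T (by simp)).trans aT
  have yT2 : Y1.vi (ν .T2) = [] := (yv .T2 (by simp)).trans aT2
  have yQ : Y1.vi (ν .Q) = [] := (yv .Q (by simp)).trans aQ
  have yG : Y1.vi (ν (.vv .G)) = G := i1
  have yRB : Y1.vi (ν (.vv .RB)) = (B.reverse).take d := i4
  have ypA : Y1.vi (ν (.vv (.pv .A))) = [] := i5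
  have ypB : Y1.vi (ν (.vv (.pv .B))) = [] := i6
  have ypF : Y1.vi (ν (.vv (.pv .F))) = [] := i7
  have ypG : Y1.vi (ν (.vv (.pv .G))) = [] := i8
  have ypH : Y1.vi (ν (.vv (.pv .H))) = [] := i9
  have ypC : Y1.vi (ν (.vv (.pv .C))) = [] := i10
  have yacc : Y1.vo (ω (.vo .acc)) = [] := i11
  have yacc2 : Y1.vo (ω (.vo .acc2)) = [] := i12
  have yaccL : Y1.vo (ω (.vo .accL)) = [] := i13
  have yaccR : Y1.vo (ω .accR) = σ.vo (ω .accR) := (yo .accR (by simp)).trans aaccR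
  have yd : Y1.sc (ρ .d) = d := (ys .d (by simp)).trans ad
  have yd1 : Y1.sc (ρ .d1) = d + 1 := (ys .d1 (by simp)).trans ad1
  have yd2 : Y1.sc (ρ .d2) = d + d := (ys .d2 (by simp)).trans ad2
  have yn : Y1.sc (ρ (.iv (.pm .n))) = σ.sc (ρ (.iv (.pm .n))) := i17.trans an
  have hGN : Reduced (σ.sc (ρ (.iv (.pm .n)))) G := i2
  -- stage 2
  have nX2a := hX2a
  simp only [yDA, yDB, yT, yT2, yQ, yG, yRB, ypA, ypB, ypF, ypG, ypH, ypC, yacc, yacc2, yaccL, yaccR, yd, yd1, yd2, yn, ← hGdef, ← hRA, ← hC1, ← hQl, ← hC2, hA', hB, htB, hdB, htA, hdA, hRBl, hGl, htG, hdG, hRAl, hC1d, hC1t, hdt, hQll, htQ, hdQ, hC2l, hC2d, divS1, divS1a, divS1b, divS2, divS2a, divS2b, divS3, divS3a, divS3b, divS4, divS5, eval_seq, eval, teeN_eq 𝓔 _ ho, moveN_eq' 𝓔, revP_eq 𝓔 hTT2, revP_eq 𝓔 hTQ,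
      NState.sc_bump, NState.sc_setSc, NState.sc_setVi, NState.sc_setVo, NState.vi_bump,
      NState.vi_setSc, NState.vi_setVi, NState.vi_setVo, NState.vo_bump, NState.vo_setSc, NState.vo_setVi, NState.vo_setVo,
      NState.steps_bump, NState.steps_setSc, NState.steps_setVi, NState.steps_setVo, NState.peak_bump, NState.peak_setSc, NState.peak_setVi,
      NState.peak_setVo, Function.update_apply, EmbeddingLike.apply_eq_iff_eq, reduceCtorEq, DivV.vv.injEq, DivS.iv.injEq, DivO.vo.injEq,
      InvV.pv.injEq, InvS.pm.injEq, InvS.ln.injEq,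
      ite_true, ite_false, not_false_eq_true, implies_true, Nat.max_zero, Nat.zero_max, Nat.le_add_right,
      List.take_length, List.drop_length, List.nil_append, List.append_nil, le_refl, List.take_append_drop, List.length_nil, List.length_append,
      List.length_reverse, List.length_take, length_mulCoeffs, List.take_take, Nat.min_self] at nX2a
  obtain ⟨baDA, baDB, baT, baT2, baQ, baRB, baG, bapA, bapB, bapF, bapG, bapH, bapC, baacc, baacc2, baaccL, baaccR, bad, bad1, bad2, ban⟩ :
      X2a.vi (ν .DA) = A ∧
      X2a.vi (ν .DB) = B ∧
      X2a.vi (ν .T) = [] ∧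
      X2a.vi (ν .T2) = A.reverse ∧
      X2a.vi (ν .Q) = [] ∧
      X2a.vi (ν (.vv .RB)) = (B.reverse).take d ∧
      X2a.vi (ν (.vv .G)) = G ∧
      X2a.vi (ν (.vv (.pv .A))) = [] ∧
      X2a.vi (ν (.vv (.pv .B))) = [] ∧
      X2a.vi (ν (.vv (.pv .F))) = [] ∧
      X2a.vi (ν (.vv (.pv .G))) = [] ∧
      X2a.vi (ν (.vv (.pv .H))) = [] ∧
      X2a.vi (ν (.vv (.pv .C))) = [] ∧
      X2a.vo (ω (.vo .acc)) = [] ∧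
      X2a.vo (ω (.vo .acc2)) = [] ∧
      X2a.vo (ω (.vo .accL)) = [] ∧
      X2a.vo (ω .accR) = σ.vo (ω .accR) ∧
      X2a.sc (ρ .d) = d ∧
      X2a.sc (ρ .d1) = d + 1 ∧
      X2a.sc (ρ .d2) = d + d ∧
      X2a.sc (ρ (.iv (.pm .n))) = σ.sc (ρ (.iv (.pm .n))) := by
    rw [nX2a]; simp only [yDA, yDB, yT, yT2, yQ, yG, yRB, ypA, ypB, ypF, ypG, ypH, ypC, yacc, yacc2, yaccL, yaccR, yd, yd1, yd2, yn, ← hGdef, ← hRA, ← hC1, ← hQl, ← hC2, hA', hB, htB, hdB, htA, hdA, hRBl, hGl, htG, hdG, hRAl, hC1d, hC1t, hdt, hQll, htQ, hdQ, hC2l, hC2d, NState.sc_bump, NState.sc_setSc, NState.sc_setVi, NState.sc_setVo, NState.vi_bump,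
      NState.vi_setSc, NState.vi_setVi, NState.vi_setVo, NState.vo_bump, NState.vo_setSc, NState.vo_setVi, NState.vo_setVo,
      NState.steps_bump, NState.steps_setSc, NState.steps_setVi, NState.steps_setVo, NState.peak_bump, NState.peak_setSc, NState.peak_setVi,
      NState.peak_setVo, Function.update_apply, EmbeddingLike.apply_eq_iff_eq, reduceCtorEq, DivV.vv.injEq, DivS.iv.injEq, DivO.vo.injEq,
      InvV.pv.injEq, InvS.pm.injEq, InvS.ln.injEq,
      ite_true, ite_false, not_false_eq_true, implies_true, Nat.max_zero, Nat.zero_max, Nat.le_add_right,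
      List.take_length, List.drop_length, List.nil_append, List.append_nil, le_refl, List.take_append_drop, List.length_nil, List.length_append,
      List.length_reverse, List.length_take, length_mulCoeffs, List.take_take, Nat.min_self, and_self, and_true, true_and]
  have bapk : X2a.peak = Y1.peak := by
    rw [nX2a]; try simp only [yDA, yDB, yT, yT2, yQ, yG, yRB, ypA, ypB, ypF, ypG, ypH, ypC, yacc, yacc2, yaccL, yaccR, yd, yd1, yd2, yn, ← hGdef, ← hRA, ← hC1, ← hQl, ← hC2, hA', hB, htB, hdB, htA, hdA, hRBl, hGl, htG, hdG, hRAl, hC1d, hC1t, hdt, hQll, htQ, hdQ, hC2l, hC2d, NState.sc_bump, NState.sc_setSc, NState.sc_setVi, NState.sc_setVo, NState.vi_bump,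
      NState.vi_setSc, NState.vi_setVi, NState.vi_setVo, NState.vo_bump, NState.vo_setSc, NState.vo_setVi, NState.vo_setVo,
      NState.steps_bump, NState.steps_setSc, NState.steps_setVi, NState.steps_setVo, NState.peak_bump, NState.peak_setSc, NState.peak_setVi,
      NState.peak_setVo, Function.update_apply, EmbeddingLike.apply_eq_iff_eq, reduceCtorEq, DivV.vv.injEq, DivS.iv.injEq, DivO.vo.injEq,
      InvV.pv.injEq, InvS.pm.injEq, InvS.ln.injEq,
      ite_true, ite_false, not_false_eq_true, implies_true, Nat.max_zero, Nat.zero_max, Nat.le_add_right,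
      List.take_length, List.drop_length, List.nil_append, List.append_nil, le_refl, List.take_append_drop, List.length_nil, List.length_append,
      List.length_reverse, List.length_take, length_mulCoeffs, List.take_take, Nat.min_self]
  have bast : X2a.steps ≤ Y1.steps + 18 * d + 4 := by
    rw [nX2a]; simp only [yDA, yDB, yT, yT2, yQ, yG, yRB, ypA, ypB, ypF, ypG, ypH, ypC, yacc, yacc2, yaccL, yaccR, yd, yd1, yd2, yn, ← hGdef, ← hRA, ← hC1, ← hQl, ← hC2, hA', hB, htB, hdB, htA, hdA, hRBl, hGl, htG, hdG, hRAl, hC1d, hC1t, hdt, hQll, htQ, hdQ, hC2l, hC2d, NState.sc_bump, NState.sc_setSc, NState.sc_setVi, NState.sc_setVo, NState.vi_bump,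
      NState.vi_setSc, NState.vi_setVi, NState.vi_setVo, NState.vo_bump, NState.vo_setSc, NState.vo_setVi, NState.vo_setVo,
      NState.steps_bump, NState.steps_setSc, NState.steps_setVi, NState.steps_setVo, NState.peak_bump, NState.peak_setSc, NState.peak_setVi,
      NState.peak_setVo, Function.update_apply, EmbeddingLike.apply_eq_iff_eq, reduceCtorEq, DivV.vv.injEq, DivS.iv.injEq, DivO.vo.injEq,
      InvV.pv.injEq, InvS.pm.injEq, InvS.ln.injEq,
      ite_true, ite_false, not_false_eq_true, implies_true, Nat.max_zero, Nat.zero_max, Nat.le_add_right,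
      List.take_length, List.drop_length, List.nil_append, List.append_nil, le_refl, List.take_append_drop, List.length_nil, List.length_append,
      List.length_reverse, List.length_take, length_mulCoeffs, List.take_take, Nat.min_self]
    clear * - hd; omega
  have ba_w : ∀ w, (∀ i, w ≠ ν i) → X2a.vi w = σ.vi w := fun w hw => by
    rw [← a_w w hw, ← i14 w (fun i => hw (.vv i)), nX2a]; simp only [hw, yDA, yDB, yT, yT2, yQ, yG, yRB, ypA, ypB, ypF, ypG, ypH, ypC, yacc, yacc2, yaccL, yaccR, yd, yd1, yd2, yn, ← hGdef, ← hRA, ← hC1, ← hQl, ← hC2, hA', hB, htB, hdB, htA, hdA, hRBl, hGl, htG, hdG, hRAl, hC1d, hC1t, hdt, hQll, htQ, hdQ, hC2l, hC2d, NState.sc_bump, NState.sc_setSc, NState.sc_setVi, NState.sc_setVo, NState.vi_bump,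
      NState.vi_setSc, NState.vi_setVi, NState.vi_setVo, NState.vo_bump, NState.vo_setSc, NState.vo_setVi, NState.vo_setVo,
      NState.steps_bump, NState.steps_setSc, NState.steps_setVi, NState.steps_setVo, NState.peak_bump, NState.peak_setSc, NState.peak_setVi,
      NState.peak_setVo, Function.update_apply, EmbeddingLike.apply_eq_iff_eq, reduceCtorEq, DivV.vv.injEq, DivS.iv.injEq, DivO.vo.injEq,
      InvV.pv.injEq, InvS.pm.injEq, InvS.ln.injEq,
      ite_true, ite_false, not_false_eq_true, implies_true, Nat.max_zero, Nat.zero_max, Nat.le_add_right,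
      List.take_length, List.drop_length, List.nil_append, List.append_nil, le_refl, List.take_append_drop, List.length_nil, List.length_append,
      List.length_reverse, List.length_take, length_mulCoeffs, List.take_take, Nat.min_self]
  have ba_p : ∀ p, (∀ i, p ≠ ω i) → X2a.vo p = σ.vo p := fun p hp => by
    rw [← a_p p hp, ← i15 p (fun i => hp (.vo i)), nX2a]; simp only [hp, yDA, yDB, yT, yT2, yQ, yG, yRB, ypA, ypB, ypF, ypG, ypH, ypC, yacc, yacc2, yaccL, yaccR, yd, yd1, yd2, yn, ← hGdef, ← hRA, ← hC1, ← hQl, ← hC2, hA', hB, htB, hdB, htA, hdA, hRBl, hGl, htG, hdG, hRAl, hC1d, hC1t, hdt, hQll, htQ, hdQ, hC2l, hC2d, NState.sc_bump, NState.sc_setSc, NState.sc_setVi, NState.sc_setVo, NState.vi_bump,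
      NState.vi_setSc, NState.vi_setVi, NState.vi_setVo, NState.vo_bump, NState.vo_setSc, NState.vo_setVi, NState.vo_setVo,
      NState.steps_bump, NState.steps_setSc, NState.steps_setVi, NState.steps_setVo, NState.peak_bump, NState.peak_setSc, NState.peak_setVi,
      NState.peak_setVo, Function.update_apply, EmbeddingLike.apply_eq_iff_eq, reduceCtorEq, DivV.vv.injEq, DivS.iv.injEq, DivO.vo.injEq,
      InvV.pv.injEq, InvS.pm.injEq, InvS.ln.injEq,
      ite_true, ite_false, not_false_eq_true, implies_true, Nat.max_zero, Nat.zero_max, Nat.le_add_right,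
      List.take_length, List.drop_length, List.nil_append, List.append_nil, le_refl, List.take_append_drop, List.length_nil, List.length_append,
      List.length_reverse, List.length_take, length_mulCoeffs, List.take_take, Nat.min_self]
  have ba_r : ∀ r, (∀ i, r ≠ ρ i) → X2a.sc r = σ.sc r := fun r hr => by
    rw [← a_r r hr, ← i16 r (fun i => hr (.iv i)), nX2a]; simp only [hr, yDA, yDB, yT, yT2, yQ, yG, yRB, ypA, ypB, ypF, ypG, ypH, ypC, yacc, yacc2, yaccL, yaccR, yd, yd1, yd2, yn, ← hGdef, ← hRA, ← hC1, ← hQl, ← hC2, hA', hB, htB, hdB, htA, hdA, hRBl, hGl, htG, hdG, hRAl, hC1d, hC1t, hdt, hQll, htQ, hdQ, hC2l, hC2d, NState.sc_bump, NState.sc_setSc, NState.sc_setVi, NState.sc_setVo, NState.vi_bump,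
      NState.vi_setSc, NState.vi_setVi, NState.vi_setVo, NState.vo_bump, NState.vo_setSc, NState.vo_setVi, NState.vo_setVo,
      NState.steps_bump, NState.steps_setSc, NState.steps_setVi, NState.steps_setVo, NState.peak_bump, NState.peak_setSc, NState.peak_setVi,
      NState.peak_setVo, Function.update_apply, EmbeddingLike.apply_eq_iff_eq, reduceCtorEq, DivV.vv.injEq, DivS.iv.injEq, DivO.vo.injEq,
      InvV.pv.injEq, InvS.pm.injEq, InvS.ln.injEq,
      ite_true, ite_false, not_false_eq_true, implies_true, Nat.max_zero, Nat.zero_max, Nat.le_add_right,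
      List.take_length, List.drop_length, List.nil_append, List.append_nil, le_refl, List.take_append_drop, List.length_nil, List.length_append,
      List.length_reverse, List.length_take, length_mulCoeffs, List.take_take, Nat.min_self]
  clear nX2a
  have nX2 := hX2
  simp only [baDA, baDB, baT, baT2, baQ, baRB, baG, bapA, bapB, bapF, bapG, bapH, bapC, baacc, baacc2, baaccL, baaccR, bad, bad1, bad2, ban, ← hGdef, ← hRA, ← hC1, ← hQl, ← hC2, hA', hB, htB, hdB, htA, hdA, hRBl, hGl, htG, hdG, hRAl, hC1d, hC1t, hdt, hQll, htQ, hdQ, hC2l, hC2d, divS1, divS1a, divS1b, divS2, divS2a, divS2b, divS3, divS3a, divS3b, divS4, divS5, eval_seq, eval, teeN_eq 𝓔 _ ho, moveN_eq' 𝓔, revP_eq 𝓔 hTT2, revP_eq 𝓔 hTQ,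
      NState.sc_bump, NState.sc_setSc, NState.sc_setVi, NState.sc_setVo, NState.vi_bump,
      NState.vi_setSc, NState.vi_setVi, NState.vi_setVo, NState.vo_bump, NState.vo_setSc, NState.vo_setVi, NState.vo_setVo,
      NState.steps_bump, NState.steps_setSc, NState.steps_setVi, NState.steps_setVo, NState.peak_bump, NState.peak_setSc, NState.peak_setVi,
      NState.peak_setVo, Function.update_apply, EmbeddingLike.apply_eq_iff_eq, reduceCtorEq, DivV.vv.injEq, DivS.iv.injEq, DivO.vo.injEq,
      InvV.pv.injEq, InvS.pm.injEq, InvS.ln.injEq,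
      ite_true, ite_false, not_false_eq_true, implies_true, Nat.max_zero, Nat.zero_max, Nat.le_add_right,
      List.take_length, List.drop_length, List.nil_append, List.append_nil, le_refl, List.take_append_drop, List.length_nil, List.length_append,
      List.length_reverse, List.length_take, length_mulCoeffs, List.take_take, Nat.min_self] at nX2
  obtain ⟨bDA, bDB, bT, bT2, bQ, bRB, bG, bpA, bpB, bpF, bpG, bpH, bpC, bacc, bacc2, baccL, baccR, bd, bd1, bd2, bn, bla, blb⟩ :
      X2.vi (ν .DA) = A ∧
      X2.vi (ν .DB) = B ∧
      X2.vi (ν .T) = [] ∧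
      X2.vi (ν .T2) = [] ∧
      X2.vi (ν .Q) = [] ∧
      X2.vi (ν (.vv .RB)) = (B.reverse).take d ∧
      X2.vi (ν (.vv .G)) = [] ∧
      X2.vi (ν (.vv (.pv .A))) = RA ∧
      X2.vi (ν (.vv (.pv .B))) = G ∧
      X2.vi (ν (.vv (.pv .F))) = [] ∧
      X2.vi (ν (.vv (.pv .G))) = [] ∧
      X2.vi (ν (.vv (.pv .H))) = [] ∧
      X2.vi (ν (.vv (.pv .C))) = [] ∧
      X2.vo (ω (.vo .acc)) = [] ∧
      X2.vo (ω (.vo .acc2)) = [] ∧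
      X2.vo (ω (.vo .accL)) = [] ∧
      X2.vo (ω .accR) = σ.vo (ω .accR) ∧
      X2.sc (ρ .d) = d ∧
      X2.sc (ρ .d1) = d + 1 ∧
      X2.sc (ρ .d2) = d + d ∧
      X2.sc (ρ (.iv (.pm .n))) = σ.sc (ρ (.iv (.pm .n))) ∧
      X2.sc (ρ (.iv (.pm .la))) = d ∧
      X2.sc (ρ (.iv (.pm .lb))) = d := by
    rw [nX2]; simp only [baDA, baDB, baT, baT2, baQ, baRB, baG, bapA, bapB, bapF, bapG, bapH, bapC, baacc, baacc2, baaccL, baaccR, bad, bad1, bad2, ban, ← hGdef, ← hRA, ← hC1, ← hQl, ← hC2, hA', hB, htB, hdB, htA, hdA, hRBl, hGl, htG, hdG, hRAl, hC1d, hC1t, hdt, hQll, htQ, hdQ, hC2l, hC2d, NState.sc_bump, NState.sc_setSc, NState.sc_setVi, NState.sc_setVo, NState.vi_bump,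
      NState.vi_setSc, NState.vi_setVi, NState.vi_setVo, NState.vo_bump, NState.vo_setSc, NState.vo_setVi, NState.vo_setVo,
      NState.steps_bump, NState.steps_setSc, NState.steps_setVi, NState.steps_setVo, NState.peak_bump, NState.peak_setSc, NState.peak_setVi,
      NState.peak_setVo, Function.update_apply, EmbeddingLike.apply_eq_iff_eq, reduceCtorEq, DivV.vv.injEq, DivS.iv.injEq, DivO.vo.injEq,
      InvV.pv.injEq, InvS.pm.injEq, InvS.ln.injEq,
      ite_true, ite_false, not_false_eq_true, implies_true, Nat.max_zero, Nat.zero_max, Nat.le_add_right,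
      List.take_length, List.drop_length, List.nil_append, List.append_nil, le_refl, List.take_append_drop, List.length_nil, List.length_append,
      List.length_reverse, List.length_take, length_mulCoeffs, List.take_take, Nat.min_self, and_self, and_true, true_and]
  have bpk : X2.peak = Y1.peak := by
    rw [nX2]; try simp only [bapk, baDA, baDB, baT, baT2, baQ, baRB, baG, bapA, bapB, bapF, bapG, bapH, bapC, baacc, baacc2, baaccL, baaccR, bad, bad1, bad2, ban, ← hGdef, ← hRA, ← hC1, ← hQl, ← hC2, hA', hB, htB, hdB, htA, hdA, hRBl, hGl, htG, hdG, hRAl, hC1d, hC1t, hdt, hQll, htQ, hdQ, hC2l, hC2d, NState.sc_bump, NState.sc_setSc, NState.sc_setVi, NState.sc_setVo, NState.vi_bump,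
      NState.vi_setSc, NState.vi_setVi, NState.vi_setVo, NState.vo_bump, NState.vo_setSc, NState.vo_setVi, NState.vo_setVo,
      NState.steps_bump, NState.steps_setSc, NState.steps_setVi, NState.steps_setVo, NState.peak_bump, NState.peak_setSc, NState.peak_setVi,
      NState.peak_setVo, Function.update_apply, EmbeddingLike.apply_eq_iff_eq, reduceCtorEq, DivV.vv.injEq, DivS.iv.injEq, DivO.vo.injEq,
      InvV.pv.injEq, InvS.pm.injEq, InvS.ln.injEq,
      ite_true, ite_false, not_false_eq_true, implies_true, Nat.max_zero, Nat.zero_max, Nat.le_add_right,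
      List.take_length, List.drop_length, List.nil_append, List.append_nil, le_refl, List.take_append_drop, List.length_nil, List.length_append,
      List.length_reverse, List.length_take, length_mulCoeffs, List.take_take, Nat.min_self]
  have bst : X2.steps ≤ Y1.steps + 30 * d + 12 := by
    rw [nX2]; simp only [baDA, baDB, baT, baT2, baQ, baRB, baG, bapA, bapB, bapF, bapG, bapH, bapC, baacc, baacc2, baaccL, baaccR, bad, bad1, bad2, ban, ← hGdef, ← hRA, ← hC1, ← hQl, ← hC2, hA', hB, htB, hdB, htA, hdA, hRBl, hGl, htG, hdG, hRAl, hC1d, hC1t, hdt, hQll, htQ, hdQ, hC2l, hC2d, NState.sc_bump, NState.sc_setSc, NState.sc_setVi, NState.sc_setVo, NState.vi_bump,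
      NState.vi_setSc, NState.vi_setVi, NState.vi_setVo, NState.vo_bump, NState.vo_setSc, NState.vo_setVi, NState.vo_setVo,
      NState.steps_bump, NState.steps_setSc, NState.steps_setVi, NState.steps_setVo, NState.peak_bump, NState.peak_setSc, NState.peak_setVi,
      NState.peak_setVo, Function.update_apply, EmbeddingLike.apply_eq_iff_eq, reduceCtorEq, DivV.vv.injEq, DivS.iv.injEq, DivO.vo.injEq,
      InvV.pv.injEq, InvS.pm.injEq, InvS.ln.injEq,
      ite_true, ite_false, not_false_eq_true, implies_true, Nat.max_zero, Nat.zero_max, Nat.le_add_right,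
      List.take_length, List.drop_length, List.nil_append, List.append_nil, le_refl, List.take_append_drop, List.length_nil, List.length_append,
      List.length_reverse, List.length_take, length_mulCoeffs, List.take_take, Nat.min_self]
    (try simp only [List.length_drop, List.length_reverse, hA', hGl]); clear * - hd bast; omega
  have b_w : ∀ w, (∀ i, w ≠ ν i) → X2.vi w = σ.vi w := fun w hw => by
    rw [← ba_w w hw, nX2]; simp only [hw, baDA, baDB, baT, baT2, baQ, baRB, baG, bapA, bapB, bapF, bapG, bapH, bapC, baacc, baacc2, baaccL, baaccR, bad, bad1, bad2, ban, ← hGdef, ← hRA, ← hC1, ← hQl, ← hC2, hA', hB, htB, hdB, htA, hdA, hRBl, hGl, htG, hdG, hRAl, hC1d, hC1t, hdt, hQll, htQ, hdQ, hC2l, hC2d, NState.sc_bump, NState.sc_setSc, NState.sc_setVi, NState.sc_setVo, NState.vi_bump,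
      NState.vi_setSc, NState.vi_setVi, NState.vi_setVo, NState.vo_bump, NState.vo_setSc, NState.vo_setVi, NState.vo_setVo,
      NState.steps_bump, NState.steps_setSc, NState.steps_setVi, NState.steps_setVo, NState.peak_bump, NState.peak_setSc, NState.peak_setVi,
      NState.peak_setVo, Function.update_apply, EmbeddingLike.apply_eq_iff_eq, reduceCtorEq, DivV.vv.injEq, DivS.iv.injEq, DivO.vo.injEq,
      InvV.pv.injEq, InvS.pm.injEq, InvS.ln.injEq,
      ite_true, ite_false, not_false_eq_true, implies_true, Nat.max_zero, Nat.zero_max, Nat.le_add_right,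
      List.take_length, List.drop_length, List.nil_append, List.append_nil, le_refl, List.take_append_drop, List.length_nil, List.length_append,
      List.length_reverse, List.length_take, length_mulCoeffs, List.take_take, Nat.min_self]
  have b_p : ∀ p, (∀ i, p ≠ ω i) → X2.vo p = σ.vo p := fun p hp => by
    rw [← ba_p p hp, nX2]; simp only [hp, baDA, baDB, baT, baT2, baQ, baRB, baG, bapA, bapB, bapF, bapG, bapH, bapC, baacc, baacc2, baaccL, baaccR, bad, bad1, bad2, ban, ← hGdef, ← hRA, ← hC1, ← hQl, ← hC2, hA', hB, htB, hdB, htA, hdA, hRBl, hGl, htG, hdG, hRAl, hC1d, hC1t, hdt, hQll, htQ, hdQ, hC2l, hC2d, NState.sc_bump, NState.sc_setSc, NState.sc_setVi, NState.sc_setVo, NState.vi_bump,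
      NState.vi_setSc, NState.vi_setVi, NState.vi_setVo, NState.vo_bump, NState.vo_setSc, NState.vo_setVi, NState.vo_setVo,
      NState.steps_bump, NState.steps_setSc, NState.steps_setVi, NState.steps_setVo, NState.peak_bump, NState.peak_setSc, NState.peak_setVi,
      NState.peak_setVo, Function.update_apply, EmbeddingLike.apply_eq_iff_eq, reduceCtorEq, DivV.vv.injEq, DivS.iv.injEq, DivO.vo.injEq,
      InvV.pv.injEq, InvS.pm.injEq, InvS.ln.injEq,
      ite_true, ite_false, not_false_eq_true, implies_true, Nat.max_zero, Nat.zero_max, Nat.le_add_right,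
      List.take_length, List.drop_length, List.nil_append, List.append_nil, le_refl, List.take_append_drop, List.length_nil, List.length_append,
      List.length_reverse, List.length_take, length_mulCoeffs, List.take_take, Nat.min_self]
  have b_r : ∀ r, (∀ i, r ≠ ρ i) → X2.sc r = σ.sc r := fun r hr => by
    rw [← ba_r r hr, nX2]; simp only [hr, baDA, baDB, baT, baT2, baQ, baRB, baG, bapA, bapB, bapF, bapG, bapH, bapC, baacc, baacc2, baaccL, baaccR, bad, bad1, bad2, ban, ← hGdef, ← hRA, ← hC1, ← hQl, ← hC2, hA', hB, htB, hdB, htA, hdA, hRBl, hGl, htG, hdG, hRAl, hC1d, hC1t, hdt, hQll, htQ, hdQ, hC2l, hC2d, NState.sc_bump, NState.sc_setSc, NState.sc_setVi, NState.sc_setVo, NState.vi_bump,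
      NState.vi_setSc, NState.vi_setVi, NState.vi_setVo, NState.vo_bump, NState.vo_setSc, NState.vo_setVi, NState.vo_setVo,
      NState.steps_bump, NState.steps_setSc, NState.steps_setVi, NState.steps_setVo, NState.peak_bump, NState.peak_setSc, NState.peak_setVi,
      NState.peak_setVo, Function.update_apply, EmbeddingLike.apply_eq_iff_eq, reduceCtorEq, DivV.vv.injEq, DivS.iv.injEq, DivO.vo.injEq,
      InvV.pv.injEq, InvS.pm.injEq, InvS.ln.injEq,
      ite_true, ite_false, not_false_eq_true, implies_true, Nat.max_zero, Nat.zero_max, Nat.le_add_right,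
      List.take_length, List.drop_length, List.nil_append, List.append_nil, le_refl, List.take_append_drop, List.length_nil, List.length_append,
      List.length_reverse, List.length_take, length_mulCoeffs, List.take_take, Nat.min_self]
  clear nX2
  -- the first product
  obtain ⟨p1, pA, pB, pF, pG, pH, pw, pvo, pn, pla, plb, pr, ppk, pst⟩ :=
    pmulP_spec (𝓔 := 𝓔) M ρq νq (ω (.vo .acc)) X2
      (by show 1 < X2.sc (ρ (.iv (.pm .n))); rw [bn]; exact hN)
      (by show X2.sc (ρ (.iv (.pm .la))) = (X2.vi (ν (.vv (.pv .A)))).length; rw [bla, bpA, hRAl])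
      (by show X2.sc (ρ (.iv (.pm .lb))) = (X2.vi (ν (.vv (.pv .B)))).length; rw [blb, bpB, hGl])
      (by show 0 < (X2.vi (ν (.vv (.pv .A)))).length; rw [bpA, hRAl]; exact hd) (by show 0 < (X2.vi (ν (.vv (.pv .B)))).length; rw [bpB, hGl]; exact hd)
      (by show ∀ x ∈ X2.vi (ν (.vv (.pv .B))), x < X2.sc (ρ (.iv (.pm .n))); rw [bpB, bn]; exact hGN) bpF bpG bpC bacc
  rw [← hY2] at p1 pA pB pF pG pH pw pvo pn pla plb pr ppk pst
  simp only [Function.Embedding.trans_apply, DivS.ivE_apply, DivV.vvE_apply, DivO.voE_apply, InvS.pmE_apply, InvV.pvE_apply, InvS.lnE_apply] at p1 pA pB pF pG pH pw pn pla plb pr ppk pst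
  rw [bn, bpA, bpB, ← hC1] at p1
  rw [bla, blb] at ppk pst
  have zv : ∀ w : DivV, (∀ i, w ≠ .vv (.pv i)) → Y2.vi (ν w) = X2.vi (ν w) := fun w hw => pw _ (fun i => by simpa using hw i)
  have zs : ∀ r : DivS, (∀ i, r ≠ .iv (.pm i)) → Y2.sc (ρ r) = X2.sc (ρ r) := fun r hr => pr _ (fun i => by simpa using hr i)
  have zDA : Y2.vi (ν .DA) = A := (zv .DA (by simp)).trans bDA
  have zDB : Y2.vi (ν .DB) = B := (zv .DB (by simp)).trans bDB
  have zT : Y2.vi (ν .T) = [] := (zv .T (by simp)).trans bT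
  have zT2 : Y2.vi (ν .T2) = [] := (zv .T2 (by simp)).trans bT2
  have zQ : Y2.vi (ν .Q) = [] := (zv .Q (by simp)).trans bQ
  have zRB : Y2.vi (ν (.vv .RB)) = (B.reverse).take d := (zv (.vv .RB) (by simp)).trans bRB
  have zG : Y2.vi (ν (.vv .G)) = [] := (zv (.vv .G) (by simp)).trans bG
  have zpA : Y2.vi (ν (.vv (.pv .A))) = [] := pA
  have zpB : Y2.vi (ν (.vv (.pv .B))) = [] := pB
  have zpF : Y2.vi (ν (.vv (.pv .F))) = [] := pF
  have zpG : Y2.vi (ν (.vv (.pv .G))) = [] := pG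
  have zpH : Y2.vi (ν (.vv (.pv .H))) = [] := pH
  have zpC : Y2.vi (ν (.vv (.pv .C))) = C1 := p1
  have zacc : Y2.vo (ω (.vo .acc)) = [] := by rw [pvo, bacc]
  have zacc2 : Y2.vo (ω (.vo .acc2)) = [] := by rw [pvo, bacc2]
  have zaccL : Y2.vo (ω (.vo .accL)) = [] := by rw [pvo, baccL]
  have zaccR : Y2.vo (ω .accR) = σ.vo (ω .accR) := by rw [pvo, baccR]
  have zd : Y2.sc (ρ .d) = d := (zs .d (by simp)).trans bd
  have zd1 : Y2.sc (ρ .d1) = d + 1 := (zs .d1 (by simp)).trans bd1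
  have zd2 : Y2.sc (ρ .d2) = d + d := (zs .d2 (by simp)).trans bd2
  have zn : Y2.sc (ρ (.iv (.pm .n))) = σ.sc (ρ (.iv (.pm .n))) := pn.trans bn
  -- stage 3
  have nX3a := hX3a
  simp only [zDA, zDB, zT, zT2, zQ, zRB, zG, zpA, zpB, zpF, zpG, zpH, zpC, zacc, zacc2, zaccL, zaccR, zd, zd1, zd2, zn, ← hGdef, ← hRA, ← hC1, ← hQl, ← hC2, hA', hB, htB, hdB, htA, hdA, hRBl, hGl, htG, hdG, hRAl, hC1d, hC1t, hdt, hQll, htQ, hdQ, hC2l, hC2d, divS1, divS1a, divS1b, divS2, divS2a, divS2b, divS3, divS3a, divS3b, divS4, divS5, eval_seq, eval, teeN_eq 𝓔 _ ho, moveN_eq' 𝓔, revP_eq 𝓔 hTT2, revP_eq 𝓔 hTQ,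
      NState.sc_bump, NState.sc_setSc, NState.sc_setVi, NState.sc_setVo, NState.vi_bump,
      NState.vi_setSc, NState.vi_setVi, NState.vi_setVo, NState.vo_bump, NState.vo_setSc, NState.vo_setVi, NState.vo_setVo,
      NState.steps_bump, NState.steps_setSc, NState.steps_setVi, NState.steps_setVo, NState.peak_bump, NState.peak_setSc, NState.peak_setVi,
      NState.peak_setVo, Function.update_apply, EmbeddingLike.apply_eq_iff_eq, reduceCtorEq, DivV.vv.injEq, DivS.iv.injEq, DivO.vo.injEq,
      InvV.pv.injEq, InvS.pm.injEq, InvS.ln.injEq,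
      ite_true, ite_false, not_false_eq_true, implies_true, Nat.max_zero, Nat.zero_max, Nat.le_add_right,
      List.take_length, List.drop_length, List.nil_append, List.append_nil, le_refl, List.take_append_drop, List.length_nil, List.length_append,
      List.length_reverse, List.length_take, length_mulCoeffs, List.take_take, Nat.min_self] at nX3a
  obtain ⟨caDA, caDB, caT, caT2, caQ, caRB, caG, capA, capB, capF, capG, capH, capC, caacc, caacc2, caaccL, caaccR, cad, cad1, cad2, can⟩ :
      X3a.vi (ν .DA) = A ∧
      X3a.vi (ν .DB) = B ∧
      X3a.vi (ν .T) = [] ∧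
      X3a.vi (ν .T2) = [] ∧
      X3a.vi (ν .Q) = Ql ∧
      X3a.vi (ν (.vv .RB)) = (B.reverse).take d ∧
      X3a.vi (ν (.vv .G)) = [] ∧
      X3a.vi (ν (.vv (.pv .A))) = [] ∧
      X3a.vi (ν (.vv (.pv .B))) = [] ∧
      X3a.vi (ν (.vv (.pv .F))) = [] ∧
      X3a.vi (ν (.vv (.pv .G))) = [] ∧
      X3a.vi (ν (.vv (.pv .H))) = [] ∧
      X3a.vi (ν (.vv (.pv .C))) = [] ∧
      X3a.vo (ω (.vo .acc)) = [] ∧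
      X3a.vo (ω (.vo .acc2)) = [] ∧
      X3a.vo (ω (.vo .accL)) = [] ∧
      X3a.vo (ω .accR) = σ.vo (ω .accR) ∧
      X3a.sc (ρ .d) = d ∧
      X3a.sc (ρ .d1) = d + 1 ∧
      X3a.sc (ρ .d2) = d + d ∧
      X3a.sc (ρ (.iv (.pm .n))) = σ.sc (ρ (.iv (.pm .n))) := by
    rw [nX3a]; simp only [zDA, zDB, zT, zT2, zQ, zRB, zG, zpA, zpB, zpF, zpG, zpH, zpC, zacc, zacc2, zaccL, zaccR, zd, zd1, zd2, zn, ← hGdef, ← hRA, ← hC1, ← hQl, ← hC2, hA', hB, htB, hdB, htA, hdA, hRBl, hGl, htG, hdG, hRAl, hC1d, hC1t, hdt, hQll, htQ, hdQ, hC2l, hC2d, NState.sc_bump, NState.sc_setSc, NState.sc_setVi, NState.sc_setVo, NState.vi_bump,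
      NState.vi_setSc, NState.vi_setVi, NState.vi_setVo, NState.vo_bump, NState.vo_setSc, NState.vo_setVi, NState.vo_setVo,
      NState.steps_bump, NState.steps_setSc, NState.steps_setVi, NState.steps_setVo, NState.peak_bump, NState.peak_setSc, NState.peak_setVi,
      NState.peak_setVo, Function.update_apply, EmbeddingLike.apply_eq_iff_eq, reduceCtorEq, DivV.vv.injEq, DivS.iv.injEq, DivO.vo.injEq,
      InvV.pv.injEq, InvS.pm.injEq, InvS.ln.injEq,
      ite_true, ite_false, not_false_eq_true, implies_true, Nat.max_zero, Nat.zero_max, Nat.le_add_right,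
      List.take_length, List.drop_length, List.nil_append, List.append_nil, le_refl, List.take_append_drop, List.length_nil, List.length_append,
      List.length_reverse, List.length_take, length_mulCoeffs, List.take_take, Nat.min_self, and_self, and_true, true_and]
  have capk : X3a.peak = Y2.peak := by
    rw [nX3a]; try simp only [zDA, zDB, zT, zT2, zQ, zRB, zG, zpA, zpB, zpF, zpG, zpH, zpC, zacc, zacc2, zaccL, zaccR, zd, zd1, zd2, zn, ← hGdef, ← hRA, ← hC1, ← hQl, ← hC2, hA', hB, htB, hdB, htA, hdA, hRBl, hGl, htG, hdG, hRAl, hC1d, hC1t, hdt, hQll, htQ, hdQ, hC2l, hC2d, NState.sc_bump, NState.sc_setSc, NState.sc_setVi, NState.sc_setVo, NState.vi_bump,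
      NState.vi_setSc, NState.vi_setVi, NState.vi_setVo, NState.vo_bump, NState.vo_setSc, NState.vo_setVi, NState.vo_setVo,
      NState.steps_bump, NState.steps_setSc, NState.steps_setVi, NState.steps_setVo, NState.peak_bump, NState.peak_setSc, NState.peak_setVi,
      NState.peak_setVo, Function.update_apply, EmbeddingLike.apply_eq_iff_eq, reduceCtorEq, DivV.vv.injEq, DivS.iv.injEq, DivO.vo.injEq,
      InvV.pv.injEq, InvS.pm.injEq, InvS.ln.injEq,
      ite_true, ite_false, not_false_eq_true, implies_true, Nat.max_zero, Nat.zero_max, Nat.le_add_right,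
      List.take_length, List.drop_length, List.nil_append, List.append_nil, le_refl, List.take_append_drop, List.length_nil, List.length_append,
      List.length_reverse, List.length_take, length_mulCoeffs, List.take_take, Nat.min_self]
  have cast : X3a.steps ≤ Y2.steps + 9 * d + 4 := by
    rw [nX3a]; simp only [zDA, zDB, zT, zT2, zQ, zRB, zG, zpA, zpB, zpF, zpG, zpH, zpC, zacc, zacc2, zaccL, zaccR, zd, zd1, zd2, zn, ← hGdef, ← hRA, ← hC1, ← hQl, ← hC2, hA', hB, htB, hdB, htA, hdA, hRBl, hGl, htG, hdG, hRAl, hC1d, hC1t, hdt, hQll, htQ, hdQ, hC2l, hC2d, NState.sc_bump, NState.sc_setSc, NState.sc_setVi, NState.sc_setVo, NState.vi_bump,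
      NState.vi_setSc, NState.vi_setVi, NState.vi_setVo, NState.vo_bump, NState.vo_setSc, NState.vo_setVi, NState.vo_setVo,
      NState.steps_bump, NState.steps_setSc, NState.steps_setVi, NState.steps_setVo, NState.peak_bump, NState.peak_setSc, NState.peak_setVi,
      NState.peak_setVo, Function.update_apply, EmbeddingLike.apply_eq_iff_eq, reduceCtorEq, DivV.vv.injEq, DivS.iv.injEq, DivO.vo.injEq,
      InvV.pv.injEq, InvS.pm.injEq, InvS.ln.injEq,
      ite_true, ite_false, not_false_eq_true, implies_true, Nat.max_zero, Nat.zero_max, Nat.le_add_right,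
      List.take_length, List.drop_length, List.nil_append, List.append_nil, le_refl, List.take_append_drop, List.length_nil, List.length_append,
      List.length_reverse, List.length_take, length_mulCoeffs, List.take_take, Nat.min_self]
    (try simp only [List.length_drop, hC1l]); clear * - hd; omega
  have ca_w : ∀ w, (∀ i, w ≠ ν i) → X3a.vi w = σ.vi w := fun w hw => by
    rw [← b_w w hw, ← pw w (fun i => hw (.vv (.pv i))), nX3a]; simp only [hw, zDA, zDB, zT, zT2, zQ, zRB, zG, zpA, zpB, zpF, zpG, zpH, zpC, zacc, zacc2, zaccL, zaccR, zd, zd1, zd2, zn, ← hGdef, ← hRA, ← hC1, ← hQl, ← hC2, hA', hB, htB, hdB, htA, hdA, hRBl, hGl, htG, hdG, hRAl, hC1d, hC1t, hdt, hQll, htQ, hdQ, hC2l, hC2d, NState.sc_bump, NState.sc_setSc, NState.sc_setVi, NState.sc_setVo, NState.vi_bump,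
      NState.vi_setSc, NState.vi_setVi, NState.vi_setVo, NState.vo_bump, NState.vo_setSc, NState.vo_setVi, NState.vo_setVo,
      NState.steps_bump, NState.steps_setSc, NState.steps_setVi, NState.steps_setVo, NState.peak_bump, NState.peak_setSc, NState.peak_setVi,
      NState.peak_setVo, Function.update_apply, EmbeddingLike.apply_eq_iff_eq, reduceCtorEq, DivV.vv.injEq, DivS.iv.injEq, DivO.vo.injEq,
      InvV.pv.injEq, InvS.pm.injEq, InvS.ln.injEq,
      ite_true, ite_false, not_false_eq_true, implies_true, Nat.max_zero, Nat.zero_max, Nat.le_add_right,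
      List.take_length, List.drop_length, List.nil_append, List.append_nil, le_refl, List.take_append_drop, List.length_nil, List.length_append,
      List.length_reverse, List.length_take, length_mulCoeffs, List.take_take, Nat.min_self]
  have ca_p : ∀ p, (∀ i, p ≠ ω i) → X3a.vo p = σ.vo p := fun p hp => by
    rw [← b_p p hp, ← pvo, nX3a]; simp only [hp, zDA, zDB, zT, zT2, zQ, zRB, zG, zpA, zpB, zpF, zpG, zpH, zpC, zacc, zacc2, zaccL, zaccR, zd, zd1, zd2, zn, ← hGdef, ← hRA, ← hC1, ← hQl, ← hC2, hA', hB, htB, hdB, htA, hdA, hRBl, hGl, htG, hdG, hRAl, hC1d, hC1t, hdt, hQll, htQ, hdQ, hC2l, hC2d, NState.sc_bump, NState.sc_setSc, NState.sc_setVi, NState.sc_setVo, NState.vi_bump,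
      NState.vi_setSc, NState.vi_setVi, NState.vi_setVo, NState.vo_bump, NState.vo_setSc, NState.vo_setVi, NState.vo_setVo,
      NState.steps_bump, NState.steps_setSc, NState.steps_setVi, NState.steps_setVo, NState.peak_bump, NState.peak_setSc, NState.peak_setVi,
      NState.peak_setVo, Function.update_apply, EmbeddingLike.apply_eq_iff_eq, reduceCtorEq, DivV.vv.injEq, DivS.iv.injEq, DivO.vo.injEq,
      InvV.pv.injEq, InvS.pm.injEq, InvS.ln.injEq,
      ite_true, ite_false, not_false_eq_true, implies_true, Nat.max_zero, Nat.zero_max, Nat.le_add_right,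
      List.take_length, List.drop_length, List.nil_append, List.append_nil, le_refl, List.take_append_drop, List.length_nil, List.length_append,
      List.length_reverse, List.length_take, length_mulCoeffs, List.take_take, Nat.min_self]
  have ca_r : ∀ r, (∀ i, r ≠ ρ i) → X3a.sc r = σ.sc r := fun r hr => by
    rw [← b_r r hr, ← pr r (fun i => hr (.iv (.pm i))), nX3a]; simp only [hr, zDA, zDB, zT, zT2, zQ, zRB, zG, zpA, zpB, zpF, zpG, zpH, zpC, zacc, zacc2, zaccL, zaccR, zd, zd1, zd2, zn, ← hGdef, ← hRA, ← hC1, ← hQl, ← hC2, hA', hB, htB, hdB, htA, hdA, hRBl, hGl, htG, hdG, hRAl, hC1d, hC1t, hdt, hQll, htQ, hdQ, hC2l, hC2d, NState.sc_bump, NState.sc_setSc, NState.sc_setVi, NState.sc_setVo, NState.vi_bump,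
      NState.vi_setSc, NState.vi_setVi, NState.vi_setVo, NState.vo_bump, NState.vo_setSc, NState.vo_setVi, NState.vo_setVo,
      NState.steps_bump, NState.steps_setSc, NState.steps_setVi, NState.steps_setVo, NState.peak_bump, NState.peak_setSc, NState.peak_setVi,
      NState.peak_setVo, Function.update_apply, EmbeddingLike.apply_eq_iff_eq, reduceCtorEq, DivV.vv.injEq, DivS.iv.injEq, DivO.vo.injEq,
      InvV.pv.injEq, InvS.pm.injEq, InvS.ln.injEq,
      ite_true, ite_false, not_false_eq_true, implies_true, Nat.max_zero, Nat.zero_max, Nat.le_add_right,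
      List.take_length, List.drop_length, List.nil_append, List.append_nil, le_refl, List.take_append_drop, List.length_nil, List.length_append,
      List.length_reverse, List.length_take, length_mulCoeffs, List.take_take, Nat.min_self]
  clear nX3a
  have nX3 := hX3
  simp only [caDA, caDB, caT, caT2, caQ, caRB, caG, capA, capB, capF, capG, capH, capC, caacc, caacc2, caaccL, caaccR, cad, cad1, cad2, can, ← hGdef, ← hRA, ← hC1, ← hQl, ← hC2, hA', hB, htB, hdB, htA, hdA, hRBl, hGl, htG, hdG, hRAl, hC1d, hC1t, hdt, hQll, htQ, hdQ, hC2l, hC2d, divS1, divS1a, divS1b, divS2, divS2a, divS2b, divS3, divS3a, divS3b, divS4, divS5, eval_seq, eval, teeN_eq 𝓔 _ ho, moveN_eq' 𝓔, revP_eq 𝓔 hTT2, revP_eq 𝓔 hTQ,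
      NState.sc_bump, NState.sc_setSc, NState.sc_setVi, NState.sc_setVo, NState.vi_bump,
      NState.vi_setSc, NState.vi_setVi, NState.vi_setVo, NState.vo_bump, NState.vo_setSc, NState.vo_setVi, NState.vo_setVo,
      NState.steps_bump, NState.steps_setSc, NState.steps_setVi, NState.steps_setVo, NState.peak_bump, NState.peak_setSc, NState.peak_setVi,
      NState.peak_setVo, Function.update_apply, EmbeddingLike.apply_eq_iff_eq, reduceCtorEq, DivV.vv.injEq, DivS.iv.injEq, DivO.vo.injEq,
      InvV.pv.injEq, InvS.pm.injEq, InvS.ln.injEq,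
      ite_true, ite_false, not_false_eq_true, implies_true, Nat.max_zero, Nat.zero_max, Nat.le_add_right,
      List.take_length, List.drop_length, List.nil_append, List.append_nil, le_refl, List.take_append_drop, List.length_nil, List.length_append,
      List.length_reverse, List.length_take, length_mulCoeffs, List.take_take, Nat.min_self] at nX3
  obtain ⟨cDA, cDB, cT, cT2, cQ, cRB, cG, cpA, cpB, cpF, cpG, cpH, cpC, cacc, cacc2, caccL, caccR, cd, cd1, cd2, cn, cla, clb⟩ :
      X3.vi (ν .DA) = A ∧
      X3.vi (ν .DB) = [] ∧
      X3.vi (ν .T) = [] ∧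
      X3.vi (ν .T2) = [] ∧
      X3.vi (ν .Q) = [] ∧
      X3.vi (ν (.vv .RB)) = (B.reverse).take d ∧
      X3.vi (ν (.vv .G)) = [] ∧
      X3.vi (ν (.vv (.pv .A))) = Ql ∧
      X3.vi (ν (.vv (.pv .B))) = B ∧
      X3.vi (ν (.vv (.pv .F))) = [] ∧
      X3.vi (ν (.vv (.pv .G))) = [] ∧
      X3.vi (ν (.vv (.pv .H))) = [] ∧
      X3.vi (ν (.vv (.pv .C))) = [] ∧
      X3.vo (ω (.vo .acc)) = [] ∧
      X3.vo (ω (.vo .acc2)) = [] ∧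
      X3.vo (ω (.vo .accL)) = [] ∧
      X3.vo (ω .accR) = σ.vo (ω .accR) ∧
      X3.sc (ρ .d) = d ∧
      X3.sc (ρ .d1) = d + 1 ∧
      X3.sc (ρ .d2) = d + d ∧
      X3.sc (ρ (.iv (.pm .n))) = σ.sc (ρ (.iv (.pm .n))) ∧
      X3.sc (ρ (.iv (.pm .la))) = d ∧
      X3.sc (ρ (.iv (.pm .lb))) = d + 1 := by
    rw [nX3]; simp only [caDA, caDB, caT, caT2, caQ, caRB, caG, capA, capB, capF, capG, capH, capC, caacc, caacc2, caaccL, caaccR, cad, cad1, cad2, can, ← hGdef, ← hRA, ← hC1, ← hQl, ← hC2, hA', hB, htB, hdB, htA, hdA, hRBl, hGl, htG, hdG, hRAl, hC1d, hC1t, hdt, hQll, htQ, hdQ, hC2l, hC2d, NState.sc_bump, NState.sc_setSc, NState.sc_setVi, NState.sc_setVo, NState.vi_bump,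
      NState.vi_setSc, NState.vi_setVi, NState.vi_setVo, NState.vo_bump, NState.vo_setSc, NState.vo_setVi, NState.vo_setVo,
      NState.steps_bump, NState.steps_setSc, NState.steps_setVi, NState.steps_setVo, NState.peak_bump, NState.peak_setSc, NState.peak_setVi,
      NState.peak_setVo, Function.update_apply, EmbeddingLike.apply_eq_iff_eq, reduceCtorEq, DivV.vv.injEq, DivS.iv.injEq, DivO.vo.injEq,
      InvV.pv.injEq, InvS.pm.injEq, InvS.ln.injEq,
      ite_true, ite_false, not_false_eq_true, implies_true, Nat.max_zero, Nat.zero_max, Nat.le_add_right,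
      List.take_length, List.drop_length, List.nil_append, List.append_nil, le_refl, List.take_append_drop, List.length_nil, List.length_append,
      List.length_reverse, List.length_take, length_mulCoeffs, List.take_take, Nat.min_self, and_self, and_true, true_and]
  have cpk : X3.peak = Y2.peak := by
    rw [nX3]; try simp only [capk, caDA, caDB, caT, caT2, caQ, caRB, caG, capA, capB, capF, capG, capH, capC, caacc, caacc2, caaccL, caaccR, cad, cad1, cad2, can, ← hGdef, ← hRA, ← hC1, ← hQl, ← hC2, hA', hB, htB, hdB, htA, hdA, hRBl, hGl, htG, hdG, hRAl, hC1d, hC1t, hdt, hQll, htQ, hdQ, hC2l, hC2d, NState.sc_bump, NState.sc_setSc, NState.sc_setVi, NState.sc_setVo, NState.vi_bump,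
      NState.vi_setSc, NState.vi_setVi, NState.vi_setVo, NState.vo_bump, NState.vo_setSc, NState.vo_setVi, NState.vo_setVo,
      NState.steps_bump, NState.steps_setSc, NState.steps_setVi, NState.steps_setVo, NState.peak_bump, NState.peak_setSc, NState.peak_setVi,
      NState.peak_setVo, Function.update_apply, EmbeddingLike.apply_eq_iff_eq, reduceCtorEq, DivV.vv.injEq, DivS.iv.injEq, DivO.vo.injEq,
      InvV.pv.injEq, InvS.pm.injEq, InvS.ln.injEq,
      ite_true, ite_false, not_false_eq_true, implies_true, Nat.max_zero, Nat.zero_max, Nat.le_add_right,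
      List.take_length, List.drop_length, List.nil_append, List.append_nil, le_refl, List.take_append_drop, List.length_nil, List.length_append,
      List.length_reverse, List.length_take, length_mulCoeffs, List.take_take, Nat.min_self]
  have cst : X3.steps ≤ Y2.steps + 20 * d + 12 := by
    rw [nX3]; simp only [caDA, caDB, caT, caT2, caQ, caRB, caG, capA, capB, capF, capG, capH, capC, caacc, caacc2, caaccL, caaccR, cad, cad1, cad2, can, ← hGdef, ← hRA, ← hC1, ← hQl, ← hC2, hA', hB, htB, hdB, htA, hdA, hRBl, hGl, htG, hdG, hRAl, hC1d, hC1t, hdt, hQll, htQ, hdQ, hC2l, hC2d, NState.sc_bump, NState.sc_setSc, NState.sc_setVi, NState.sc_setVo, NState.vi_bump,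
      NState.vi_setSc, NState.vi_setVi, NState.vi_setVo, NState.vo_bump, NState.vo_setSc, NState.vo_setVi, NState.vo_setVo,
      NState.steps_bump, NState.steps_setSc, NState.steps_setVi, NState.steps_setVo, NState.peak_bump, NState.peak_setSc, NState.peak_setVi,
      NState.peak_setVo, Function.update_apply, EmbeddingLike.apply_eq_iff_eq, reduceCtorEq, DivV.vv.injEq, DivS.iv.injEq, DivO.vo.injEq,
      InvV.pv.injEq, InvS.pm.injEq, InvS.ln.injEq,
      ite_true, ite_false, not_false_eq_true, implies_true, Nat.max_zero, Nat.zero_max, Nat.le_add_right,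
      List.take_length, List.drop_length, List.nil_append, List.append_nil, le_refl, List.take_append_drop, List.length_nil, List.length_append,
      List.length_reverse, List.length_take, length_mulCoeffs, List.take_take, Nat.min_self]
    clear * - hd cast; omega
  have c_w : ∀ w, (∀ i, w ≠ ν i) → X3.vi w = σ.vi w := fun w hw => by
    rw [← ca_w w hw, nX3]; simp only [hw, caDA, caDB, caT, caT2, caQ, caRB, caG, capA, capB, capF, capG, capH, capC, caacc, caacc2, caaccL, caaccR, cad, cad1, cad2, can, ← hGdef, ← hRA, ← hC1, ← hQl, ← hC2, hA', hB, htB, hdB, htA, hdA, hRBl, hGl, htG, hdG, hRAl, hC1d, hC1t, hdt, hQll, htQ, hdQ, hC2l, hC2d, NState.sc_bump, NState.sc_setSc, NState.sc_setVi, NState.sc_setVo, NState.vi_bump,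
      NState.vi_setSc, NState.vi_setVi, NState.vi_setVo, NState.vo_bump, NState.vo_setSc, NState.vo_setVi, NState.vo_setVo,
      NState.steps_bump, NState.steps_setSc, NState.steps_setVi, NState.steps_setVo, NState.peak_bump, NState.peak_setSc, NState.peak_setVi,
      NState.peak_setVo, Function.update_apply, EmbeddingLike.apply_eq_iff_eq, reduceCtorEq, DivV.vv.injEq, DivS.iv.injEq, DivO.vo.injEq,
      InvV.pv.injEq, InvS.pm.injEq, InvS.ln.injEq,
      ite_true, ite_false, not_false_eq_true, implies_true, Nat.max_zero, Nat.zero_max, Nat.le_add_right,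
      List.take_length, List.drop_length, List.nil_append, List.append_nil, le_refl, List.take_append_drop, List.length_nil, List.length_append,
      List.length_reverse, List.length_take, length_mulCoeffs, List.take_take, Nat.min_self]
  have c_p : ∀ p, (∀ i, p ≠ ω i) → X3.vo p = σ.vo p := fun p hp => by
    rw [← ca_p p hp, nX3]; simp only [hp, caDA, caDB, caT, caT2, caQ, caRB, caG, capA, capB, capF, capG, capH, capC, caacc, caacc2, caaccL, caaccR, cad, cad1, cad2, can, ← hGdef, ← hRA, ← hC1, ← hQl, ← hC2, hA', hB, htB, hdB, htA, hdA, hRBl, hGl, htG, hdG, hRAl, hC1d, hC1t, hdt, hQll, htQ, hdQ, hC2l, hC2d, NState.sc_bump, NState.sc_setSc, NState.sc_setVi, NState.sc_setVo, NState.vi_bump,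
      NState.vi_setSc, NState.vi_setVi, NState.vi_setVo, NState.vo_bump, NState.vo_setSc, NState.vo_setVi, NState.vo_setVo,
      NState.steps_bump, NState.steps_setSc, NState.steps_setVi, NState.steps_setVo, NState.peak_bump, NState.peak_setSc, NState.peak_setVi,
      NState.peak_setVo, Function.update_apply, EmbeddingLike.apply_eq_iff_eq, reduceCtorEq, DivV.vv.injEq, DivS.iv.injEq, DivO.vo.injEq,
      InvV.pv.injEq, InvS.pm.injEq, InvS.ln.injEq,
      ite_true, ite_false, not_false_eq_true, implies_true, Nat.max_zero, Nat.zero_max, Nat.le_add_right,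
      List.take_length, List.drop_length, List.nil_append, List.append_nil, le_refl, List.take_append_drop, List.length_nil, List.length_append,
      List.length_reverse, List.length_take, length_mulCoeffs, List.take_take, Nat.min_self]
  have c_r : ∀ r, (∀ i, r ≠ ρ i) → X3.sc r = σ.sc r := fun r hr => by
    rw [← ca_r r hr, nX3]; simp only [hr, caDA, caDB, caT, caT2, caQ, caRB, caG, capA, capB, capF, capG, capH, capC, caacc, caacc2, caaccL, caaccR, cad, cad1, cad2, can, ← hGdef, ← hRA, ← hC1, ← hQl, ← hC2, hA', hB, htB, hdB, htA, hdA, hRBl, hGl, htG, hdG, hRAl, hC1d, hC1t, hdt, hQll, htQ, hdQ, hC2l, hC2d, NState.sc_bump, NState.sc_setSc, NState.sc_setVi, NState.sc_setVo, NState.vi_bump,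
      NState.vi_setSc, NState.vi_setVi, NState.vi_setVo, NState.vo_bump, NState.vo_setSc, NState.vo_setVi, NState.vo_setVo,
      NState.steps_bump, NState.steps_setSc, NState.steps_setVi, NState.steps_setVo, NState.peak_bump, NState.peak_setSc, NState.peak_setVi,
      NState.peak_setVo, Function.update_apply, EmbeddingLike.apply_eq_iff_eq, reduceCtorEq, DivV.vv.injEq, DivS.iv.injEq, DivO.vo.injEq,
      InvV.pv.injEq, InvS.pm.injEq, InvS.ln.injEq,
      ite_true, ite_false, not_false_eq_true, implies_true, Nat.max_zero, Nat.zero_max, Nat.le_add_right,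
      List.take_length, List.drop_length, List.nil_append, List.append_nil, le_refl, List.take_append_drop, List.length_nil, List.length_append,
      List.length_reverse, List.length_take, length_mulCoeffs, List.take_take, Nat.min_self]
  clear nX3
  -- the second product
  have hQN : Reduced (σ.sc (ρ (.iv (.pm .n)))) Ql := fun x hx => by
    rw [hQl, List.mem_reverse] at hx; rw [hC1] at hx; exact lt_of_mem_mulCoeffs hN (List.mem_of_mem_take hx)
  obtain ⟨q1, qA, qB, qF, qG, qH, qw, qvo, qn, qla, qlb, qr, qpk, qst⟩ :=
    pmulP_spec (𝓔 := 𝓔) M ρq νq (ω (.vo .acc)) X3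
      (by show 1 < X3.sc (ρ (.iv (.pm .n))); rw [cn]; exact hN)
      (by show X3.sc (ρ (.iv (.pm .la))) = (X3.vi (ν (.vv (.pv .A)))).length; rw [cla, cpA, hQll])
      (by show X3.sc (ρ (.iv (.pm .lb))) = (X3.vi (ν (.vv (.pv .B)))).length; rw [clb, cpB, hB])
      (by show 0 < (X3.vi (ν (.vv (.pv .A)))).length; rw [cpA, hQll]; exact hd) (by show 0 < (X3.vi (ν (.vv (.pv .B)))).length; rw [cpB, hB]; exact Nat.succ_pos d)
      (by show ∀ x ∈ X3.vi (ν (.vv (.pv .B))), x < X3.sc (ρ (.iv (.pm .n))); rw [cpB, cn]; exact hBN) cpF cpG cpC cacc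
  rw [← hY3] at q1 qA qB qF qG qH qw qvo qn qla qlb qr qpk qst
  simp only [Function.Embedding.trans_apply, DivS.ivE_apply, DivV.vvE_apply, DivO.voE_apply, InvS.pmE_apply, InvV.pvE_apply, InvS.lnE_apply] at q1 qA qB qF qG qH qw qn qla qlb qr qpk qst
  rw [cn, cpA, cpB, ← hC2] at q1
  rw [cla, clb] at qpk qst
  have vv' : ∀ w : DivV, (∀ i, w ≠ .vv (.pv i)) → Y3.vi (ν w) = X3.vi (ν w) := fun w hw => qw _ (fun i => by simpa using hw i)
  have vs' : ∀ r : DivS, (∀ i, r ≠ .iv (.pm i)) → Y3.sc (ρ r) = X3.sc (ρ r) := fun r hr => qr _ (fun i => by simpa using hr i)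
  have vDA : Y3.vi (ν .DA) = A := (vv' .DA (by simp)).trans cDA
  have vDB : Y3.vi (ν .DB) = [] := (vv' .DB (by simp)).trans cDB
  have vT : Y3.vi (ν .T) = [] := (vv' .T (by simp)).trans cT
  have vT2 : Y3.vi (ν .T2) = [] := (vv' .T2 (by simp)).trans cT2
  have vQ : Y3.vi (ν .Q) = [] := (vv' .Q (by simp)).trans cQ
  have vRB : Y3.vi (ν (.vv .RB)) = (B.reverse).take d := (vv' (.vv .RB) (by simp)).trans cRB
  have vG : Y3.vi (ν (.vv .G)) = [] := (vv' (.vv .G) (by simp)).trans cG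
  have vpA : Y3.vi (ν (.vv (.pv .A))) = [] := qA
  have vpB : Y3.vi (ν (.vv (.pv .B))) = [] := qB
  have vpF : Y3.vi (ν (.vv (.pv .F))) = [] := qF
  have vpG : Y3.vi (ν (.vv (.pv .G))) = [] := qG
  have vpH : Y3.vi (ν (.vv (.pv .H))) = [] := qH
  have vpC : Y3.vi (ν (.vv (.pv .C))) = C2 := q1
  have vacc : Y3.vo (ω (.vo .acc)) = [] := by rw [qvo, cacc]
  have vacc2 : Y3.vo (ω (.vo .acc2)) = [] := by rw [qvo, cacc2]
  have vaccL : Y3.vo (ω (.vo .accL)) = [] := by rw [qvo, caccL]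
  have vaccR : Y3.vo (ω .accR) = σ.vo (ω .accR) := by rw [qvo, caccR]
  have vd : Y3.sc (ρ .d) = d := (vs' .d (by simp)).trans cd
  have vn : Y3.sc (ρ (.iv (.pm .n))) = σ.sc (ρ (.iv (.pm .n))) := qn.trans cn
  -- stage 4
  have nX4 := hX4
  simp only [vDA, vDB, vT, vT2, vQ, vRB, vG, vpA, vpB, vpF, vpG, vpH, vpC, vacc, vacc2, vaccL, vaccR, vd, vn, ← hGdef, ← hRA, ← hC1, ← hQl, ← hC2, hA', hB, htB, hdB, htA, hdA, hRBl, hGl, htG, hdG, hRAl, hC1d, hC1t, hdt, hQll, htQ, hdQ, hC2l, hC2d, divS1, divS1a, divS1b, divS2, divS2a, divS2b, divS3, divS3a, divS3b, divS4, divS5, eval_seq, eval, teeN_eq 𝓔 _ ho, moveN_eq' 𝓔, revP_eq 𝓔 hTT2, revP_eq 𝓔 hTQ,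
      NState.sc_bump, NState.sc_setSc, NState.sc_setVi, NState.sc_setVo, NState.vi_bump,
      NState.vi_setSc, NState.vi_setVi, NState.vi_setVo, NState.vo_bump, NState.vo_setSc, NState.vo_setVi, NState.vo_setVo,
      NState.steps_bump, NState.steps_setSc, NState.steps_setVi, NState.steps_setVo, NState.peak_bump, NState.peak_setSc, NState.peak_setVi,
      NState.peak_setVo, Function.update_apply, EmbeddingLike.apply_eq_iff_eq, reduceCtorEq, DivV.vv.injEq, DivS.iv.injEq, DivO.vo.injEq,
      InvV.pv.injEq, InvS.pm.injEq, InvS.ln.injEq,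
      ite_true, ite_false, not_false_eq_true, implies_true, Nat.max_zero, Nat.zero_max, Nat.le_add_right,
      List.take_length, List.drop_length, List.nil_append, List.append_nil, le_refl, List.take_append_drop, List.length_nil, List.length_append,
      List.length_reverse, List.length_take, length_mulCoeffs, List.take_take, Nat.min_self] at nX4
  obtain ⟨eDA, eDB, eT, eT2, eQ, eRB, eG, epA, epB, epF, epG, epH, epC, eacc, eacc2, eaccL, eaccR, ed, en, ecu, ecv, eln, ecnt⟩ :
      X4.vi (ν .DA) = A ∧
      X4.vi (ν .DB) = [] ∧
      X4.vi (ν .T) = [] ∧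
      X4.vi (ν .T2) = [] ∧
      X4.vi (ν .Q) = [] ∧
      X4.vi (ν (.vv .RB)) = (B.reverse).take d ∧
      X4.vi (ν (.vv .G)) = [] ∧
      X4.vi (ν (.vv (.pv .A))) = [] ∧
      X4.vi (ν (.vv (.pv .B))) = [] ∧
      X4.vi (ν (.vv (.pv .F))) = [] ∧
      X4.vi (ν (.vv (.pv .G))) = [] ∧
      X4.vi (ν (.vv (.pv .H))) = [] ∧
      X4.vi (ν (.vv (.pv .C))) = C2 ∧
      X4.vo (ω (.vo .acc)) = [] ∧
      X4.vo (ω (.vo .acc2)) = [] ∧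
      X4.vo (ω (.vo .accL)) = [] ∧
      X4.vo (ω .accR) = σ.vo (ω .accR) ∧
      X4.sc (ρ .d) = d ∧
      X4.sc (ρ (.iv (.pm .n))) = σ.sc (ρ (.iv (.pm .n))) ∧
      X4.sc (ρ (.iv (.ln .cu))) = 1 ∧
      X4.sc (ρ (.iv (.ln .cv))) = 1 ∧
      X4.sc (ρ (.iv (.ln .n))) = σ.sc (ρ (.iv (.pm .n))) ∧
      X4.sc (ρ (.iv (.ln .cnt))) = d := by
    rw [nX4]; simp only [vDA, vDB, vT, vT2, vQ, vRB, vG, vpA, vpB, vpF, vpG, vpH, vpC, vacc, vacc2, vaccL, vaccR, vd, vn, ← hGdef, ← hRA, ← hC1, ← hQl, ← hC2, hA', hB, htB, hdB, htA, hdA, hRBl, hGl, htG, hdG, hRAl, hC1d, hC1t, hdt, hQll, htQ, hdQ, hC2l, hC2d, NState.sc_bump, NState.sc_setSc, NState.sc_setVi, NState.sc_setVo, NState.vi_bump,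
      NState.vi_setSc, NState.vi_setVi, NState.vi_setVo, NState.vo_bump, NState.vo_setSc, NState.vo_setVi, NState.vo_setVo,
      NState.steps_bump, NState.steps_setSc, NState.steps_setVi, NState.steps_setVo, NState.peak_bump, NState.peak_setSc, NState.peak_setVi,
      NState.peak_setVo, Function.update_apply, EmbeddingLike.apply_eq_iff_eq, reduceCtorEq, DivV.vv.injEq, DivS.iv.injEq, DivO.vo.injEq,
      InvV.pv.injEq, InvS.pm.injEq, InvS.ln.injEq,
      ite_true, ite_false, not_false_eq_true, implies_true, Nat.max_zero, Nat.zero_max, Nat.le_add_right,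
      List.take_length, List.drop_length, List.nil_append, List.append_nil, le_refl, List.take_append_drop, List.length_nil, List.length_append,
      List.length_reverse, List.length_take, length_mulCoeffs, List.take_take, Nat.min_self, and_self, and_true, true_and]
  have epk : X4.peak = max (max Y3.peak 1) 1 := by
    rw [nX4]; try simp only [vDA, vDB, vT, vT2, vQ, vRB, vG, vpA, vpB, vpF, vpG, vpH, vpC, vacc, vacc2, vaccL, vaccR, vd, vn, ← hGdef, ← hRA, ← hC1, ← hQl, ← hC2, hA', hB, htB, hdB, htA, hdA, hRBl, hGl, htG, hdG, hRAl, hC1d, hC1t, hdt, hQll, htQ, hdQ, hC2l, hC2d, NState.sc_bump, NState.sc_setSc, NState.sc_setVi, NState.sc_setVo, NState.vi_bump,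
      NState.vi_setSc, NState.vi_setVi, NState.vi_setVo, NState.vo_bump, NState.vo_setSc, NState.vo_setVi, NState.vo_setVo,
      NState.steps_bump, NState.steps_setSc, NState.steps_setVi, NState.steps_setVo, NState.peak_bump, NState.peak_setSc, NState.peak_setVi,
      NState.peak_setVo, Function.update_apply, EmbeddingLike.apply_eq_iff_eq, reduceCtorEq, DivV.vv.injEq, DivS.iv.injEq, DivO.vo.injEq,
      InvV.pv.injEq, InvS.pm.injEq, InvS.ln.injEq,
      ite_true, ite_false, not_false_eq_true, implies_true, Nat.max_zero, Nat.zero_max, Nat.le_add_right,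
      List.take_length, List.drop_length, List.nil_append, List.append_nil, le_refl, List.take_append_drop, List.length_nil, List.length_append,
      List.length_reverse, List.length_take, length_mulCoeffs, List.take_take, Nat.min_self]
  have est : X4.steps = Y3.steps + 1 + 1 + 1 + 1 := by
    rw [nX4]; try simp only [vDA, vDB, vT, vT2, vQ, vRB, vG, vpA, vpB, vpF, vpG, vpH, vpC, vacc, vacc2, vaccL, vaccR, vd, vn, ← hGdef, ← hRA, ← hC1, ← hQl, ← hC2, hA', hB, htB, hdB, htA, hdA, hRBl, hGl, htG, hdG, hRAl, hC1d, hC1t, hdt, hQll, htQ, hdQ, hC2l, hC2d, NState.sc_bump, NState.sc_setSc, NState.sc_setVi, NState.sc_setVo, NState.vi_bump,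
      NState.vi_setSc, NState.vi_setVi, NState.vi_setVo, NState.vo_bump, NState.vo_setSc, NState.vo_setVi, NState.vo_setVo,
      NState.steps_bump, NState.steps_setSc, NState.steps_setVi, NState.steps_setVo, NState.peak_bump, NState.peak_setSc, NState.peak_setVi,
      NState.peak_setVo, Function.update_apply, EmbeddingLike.apply_eq_iff_eq, reduceCtorEq, DivV.vv.injEq, DivS.iv.injEq, DivO.vo.injEq,
      InvV.pv.injEq, InvS.pm.injEq, InvS.ln.injEq,
      ite_true, ite_false, not_false_eq_true, implies_true, Nat.max_zero, Nat.zero_max, Nat.le_add_right,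
      List.take_length, List.drop_length, List.nil_append, List.append_nil, le_refl, List.take_append_drop, List.length_nil, List.length_append,
      List.length_reverse, List.length_take, length_mulCoeffs, List.take_take, Nat.min_self]
  have e_w : ∀ w, (∀ i, w ≠ ν i) → X4.vi w = σ.vi w := fun w hw => by
    rw [← c_w w hw, ← qw w (fun i => hw (.vv (.pv i))), nX4]; simp only [hw, vDA, vDB, vT, vT2, vQ, vRB, vG, vpA, vpB, vpF, vpG, vpH, vpC, vacc, vacc2, vaccL, vaccR, vd, vn, ← hGdef, ← hRA, ← hC1, ← hQl, ← hC2, hA', hB, htB, hdB, htA, hdA, hRBl, hGl, htG, hdG, hRAl, hC1d, hC1t, hdt, hQll, htQ, hdQ, hC2l, hC2d, NState.sc_bump, NState.sc_setSc, NState.sc_setVi, NState.sc_setVo, NState.vi_bump,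
      NState.vi_setSc, NState.vi_setVi, NState.vi_setVo, NState.vo_bump, NState.vo_setSc, NState.vo_setVi, NState.vo_setVo,
      NState.steps_bump, NState.steps_setSc, NState.steps_setVi, NState.steps_setVo, NState.peak_bump, NState.peak_setSc, NState.peak_setVi,
      NState.peak_setVo, Function.update_apply, EmbeddingLike.apply_eq_iff_eq, reduceCtorEq, DivV.vv.injEq, DivS.iv.injEq, DivO.vo.injEq,
      InvV.pv.injEq, InvS.pm.injEq, InvS.ln.injEq,
      ite_true, ite_false, not_false_eq_true, implies_true, Nat.max_zero, Nat.zero_max, Nat.le_add_right,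
      List.take_length, List.drop_length, List.nil_append, List.append_nil, le_refl, List.take_append_drop, List.length_nil, List.length_append,
      List.length_reverse, List.length_take, length_mulCoeffs, List.take_take, Nat.min_self]
  have e_p : ∀ p, (∀ i, p ≠ ω i) → X4.vo p = σ.vo p := fun p hp => by
    rw [← c_p p hp, ← qvo, nX4]; simp only [hp, vDA, vDB, vT, vT2, vQ, vRB, vG, vpA, vpB, vpF, vpG, vpH, vpC, vacc, vacc2, vaccL, vaccR, vd, vn, ← hGdef, ← hRA, ← hC1, ← hQl, ← hC2, hA', hB, htB, hdB, htA, hdA, hRBl, hGl, htG, hdG, hRAl, hC1d, hC1t, hdt, hQll, htQ, hdQ, hC2l, hC2d, NState.sc_bump, NState.sc_setSc, NState.sc_setVi, NState.sc_setVo, NState.vi_bump,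
      NState.vi_setSc, NState.vi_setVi, NState.vi_setVo, NState.vo_bump, NState.vo_setSc, NState.vo_setVi, NState.vo_setVo,
      NState.steps_bump, NState.steps_setSc, NState.steps_setVi, NState.steps_setVo, NState.peak_bump, NState.peak_setSc, NState.peak_setVi,
      NState.peak_setVo, Function.update_apply, EmbeddingLike.apply_eq_iff_eq, reduceCtorEq, DivV.vv.injEq, DivS.iv.injEq, DivO.vo.injEq,
      InvV.pv.injEq, InvS.pm.injEq, InvS.ln.injEq,
      ite_true, ite_false, not_false_eq_true, implies_true, Nat.max_zero, Nat.zero_max, Nat.le_add_right,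
      List.take_length, List.drop_length, List.nil_append, List.append_nil, le_refl, List.take_append_drop, List.length_nil, List.length_append,
      List.length_reverse, List.length_take, length_mulCoeffs, List.take_take, Nat.min_self]
  have e_r : ∀ r, (∀ i, r ≠ ρ i) → X4.sc r = σ.sc r := fun r hr => by
    rw [← c_r r hr, ← qr r (fun i => hr (.iv (.pm i))), nX4]; simp only [hr, vDA, vDB, vT, vT2, vQ, vRB, vG, vpA, vpB, vpF, vpG, vpH, vpC, vacc, vacc2, vaccL, vaccR, vd, vn, ← hGdef, ← hRA, ← hC1, ← hQl, ← hC2, hA', hB, htB, hdB, htA, hdA, hRBl, hGl, htG, hdG, hRAl, hC1d, hC1t, hdt, hQll, htQ, hdQ, hC2l, hC2d, NState.sc_bump, NState.sc_setSc, NState.sc_setVi, NState.sc_setVo, NState.vi_bump,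
      NState.vi_setSc, NState.vi_setVi, NState.vi_setVo, NState.vo_bump, NState.vo_setSc, NState.vo_setVi, NState.vo_setVo,
      NState.steps_bump, NState.steps_setSc, NState.steps_setVi, NState.steps_setVo, NState.peak_bump, NState.peak_setSc, NState.peak_setVi,
      NState.peak_setVo, Function.update_apply, EmbeddingLike.apply_eq_iff_eq, reduceCtorEq, DivV.vv.injEq, DivS.iv.injEq, DivO.vo.injEq,
      InvV.pv.injEq, InvS.pm.injEq, InvS.ln.injEq,
      ite_true, ite_false, not_false_eq_true, implies_true, Nat.max_zero, Nat.zero_max, Nat.le_add_right,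
      List.take_length, List.drop_length, List.nil_append, List.append_nil, le_refl, List.take_append_drop, List.length_nil, List.length_append,
      List.length_reverse, List.length_take, length_mulCoeffs, List.take_take, Nat.min_self]
  clear nX4
  -- the subtraction
  have huv : ν .DA ≠ ν (.vv (.pv .C)) := by simp
  obtain ⟨l1, l2, l3, l4, l5, l6, l7, l8, l9⟩ := linP_spec 𝓔 ρm (ν .DA) (ν (.vv (.pv .C))) (ω .accR) huv X4 (U := σ.sc (ρ (.iv (.pm .n))))
    (by rw [eDA]; exact fun a ha => (hAN a ha).le)
    (by simp only [Function.Embedding.trans_apply, DivS.ivE_apply, DivV.vvE_apply, DivO.voE_apply, InvS.pmE_apply, InvV.pvE_apply, InvS.lnE_apply]; rw [ecnt, epC]; exact hC2d)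
  simp only [Function.Embedding.trans_apply, DivS.ivE_apply, DivV.vvE_apply, DivO.voE_apply, InvS.pmE_apply, InvV.pvE_apply, InvS.lnE_apply] at l1 l2 l3 l4 l5 l6 l7 l8 l9
  rw [eDA, ecnt] at l1
  rw [epC, ecnt] at l2
  rw [eaccR, eln, ecu, ecv, eDA, epC, ecnt] at l3
  rw [ecu, ecv, eln, epk] at l8
  rw [ecnt, est] at l9
  have wv : ∀ w, w ≠ ν .DA → w ≠ ν (.vv (.pv .C)) → ((linP (InvS.lnE.trans (DivS.ivE.trans ρ)) (ν .DA) (ν (.vv (.pv .C))) (ω .accR) : NCom S V O E).eval 𝓔 X4).vi w = X4.vi w := l6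
  have wo : ∀ p, p ≠ ω .accR → ((linP (InvS.lnE.trans (DivS.ivE.trans ρ)) (ν .DA) (ν (.vv (.pv .C))) (ω .accR) : NCom S V O E).eval 𝓔 X4).vo p = X4.vo p := l7
  have ws : ∀ r : DivS, (∀ i, r ≠ .iv (.ln i)) → ((linP (InvS.lnE.trans (DivS.ivE.trans ρ)) (ν .DA) (ν (.vv (.pv .C))) (ω .accR) : NCom S V O E).eval 𝓔 X4).sc (ρ r) = X4.sc (ρ r) := fun r hr => l5 _ (fun i => by simpa using hr i)
  have lDB : ((linP (InvS.lnE.trans (DivS.ivE.trans ρ)) (ν .DA) (ν (.vv (.pv .C))) (ω .accR) : NCom S V O E).eval 𝓔 X4).vi (ν .DB) = [] := (wv _ (by simp) (by simp)).trans eDB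
  have lT : ((linP (InvS.lnE.trans (DivS.ivE.trans ρ)) (ν .DA) (ν (.vv (.pv .C))) (ω .accR) : NCom S V O E).eval 𝓔 X4).vi (ν .T) = [] := (wv _ (by simp) (by simp)).trans eT
  have lT2 : ((linP (InvS.lnE.trans (DivS.ivE.trans ρ)) (ν .DA) (ν (.vv (.pv .C))) (ω .accR) : NCom S V O E).eval 𝓔 X4).vi (ν .T2) = [] := (wv _ (by simp) (by simp)).trans eT2
  have lQ : ((linP (InvS.lnE.trans (DivS.ivE.trans ρ)) (ν .DA) (ν (.vv (.pv .C))) (ω .accR) : NCom S V O E).eval 𝓔 X4).vi (ν .Q) = [] := (wv _ (by simp) (by simp)).trans eQ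
  have lRB : ((linP (InvS.lnE.trans (DivS.ivE.trans ρ)) (ν .DA) (ν (.vv (.pv .C))) (ω .accR) : NCom S V O E).eval 𝓔 X4).vi (ν (.vv .RB)) = (B.reverse).take d := (wv _ (by simp) (by simp)).trans eRB
  have lG : ((linP (InvS.lnE.trans (DivS.ivE.trans ρ)) (ν .DA) (ν (.vv (.pv .C))) (ω .accR) : NCom S V O E).eval 𝓔 X4).vi (ν (.vv .G)) = [] := (wv _ (by simp) (by simp)).trans eG
  have lpA : ((linP (InvS.lnE.trans (DivS.ivE.trans ρ)) (ν .DA) (ν (.vv (.pv .C))) (ω .accR) : NCom S V O E).eval 𝓔 X4).vi (ν (.vv (.pv .A))) = [] := (wv _ (by simp) (by simp)).trans epA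
  have lpB : ((linP (InvS.lnE.trans (DivS.ivE.trans ρ)) (ν .DA) (ν (.vv (.pv .C))) (ω .accR) : NCom S V O E).eval 𝓔 X4).vi (ν (.vv (.pv .B))) = [] := (wv _ (by simp) (by simp)).trans epB
  have lpF : ((linP (InvS.lnE.trans (DivS.ivE.trans ρ)) (ν .DA) (ν (.vv (.pv .C))) (ω .accR) : NCom S V O E).eval 𝓔 X4).vi (ν (.vv (.pv .F))) = [] := (wv _ (by simp) (by simp)).trans epF
  have lpG : ((linP (InvS.lnE.trans (DivS.ivE.trans ρ)) (ν .DA) (ν (.vv (.pv .C))) (ω .accR) : NCom S V O E).eval 𝓔 X4).vi (ν (.vv (.pv .G))) = [] := (wv _ (by simp) (by simp)).trans epG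
  have lpH : ((linP (InvS.lnE.trans (DivS.ivE.trans ρ)) (ν .DA) (ν (.vv (.pv .C))) (ω .accR) : NCom S V O E).eval 𝓔 X4).vi (ν (.vv (.pv .H))) = [] := (wv _ (by simp) (by simp)).trans epH
  have lacc : ((linP (InvS.lnE.trans (DivS.ivE.trans ρ)) (ν .DA) (ν (.vv (.pv .C))) (ω .accR) : NCom S V O E).eval 𝓔 X4).vo (ω (.vo .acc)) = [] := (wo _ (by simp)).trans eacc
  have lacc2 : ((linP (InvS.lnE.trans (DivS.ivE.trans ρ)) (ν .DA) (ν (.vv (.pv .C))) (ω .accR) : NCom S V O E).eval 𝓔 X4).vo (ω (.vo .acc2)) = [] := (wo _ (by simp)).trans eacc2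
  have laccL : ((linP (InvS.lnE.trans (DivS.ivE.trans ρ)) (ν .DA) (ν (.vv (.pv .C))) (ω .accR) : NCom S V O E).eval 𝓔 X4).vo (ω (.vo .accL)) = [] := (wo _ (by simp)).trans eaccL
  have ld : ((linP (InvS.lnE.trans (DivS.ivE.trans ρ)) (ν .DA) (ν (.vv (.pv .C))) (ω .accR) : NCom S V O E).eval 𝓔 X4).sc (ρ .d) = d := (ws .d (by simp)).trans ed
  have ln' : ((linP (InvS.lnE.trans (DivS.ivE.trans ρ)) (ν .DA) (ν (.vv (.pv .C))) (ω .accR) : NCom S V O E).eval 𝓔 X4).sc (ρ (.iv (.pm .n))) = σ.sc (ρ (.iv (.pm .n))) := (ws (.iv (.pm .n)) (by simp)).trans en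
  -- the clean-up
  have nT := hτ
  simp only [l1, l2, l3, lDB, lT, lT2, lQ, lRB, lG, lpA, lpB, lpF, lpG, lpH, lacc, lacc2, laccL, ld, ln', ← hGdef, ← hRA, ← hC1, ← hQl, ← hC2, hA', hB, htB, hdB, htA, hdA, hRBl, hGl, htG, hdG, hRAl, hC1d, hC1t, hdt, hQll, htQ, hdQ, hC2l, hC2d, divS1, divS1a, divS1b, divS2, divS2a, divS2b, divS3, divS3a, divS3b, divS4, divS5, eval_seq, eval, teeN_eq 𝓔 _ ho, moveN_eq' 𝓔, revP_eq 𝓔 hTT2, revP_eq 𝓔 hTQ,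
      NState.sc_bump, NState.sc_setSc, NState.sc_setVi, NState.sc_setVo, NState.vi_bump,
      NState.vi_setSc, NState.vi_setVi, NState.vi_setVo, NState.vo_bump, NState.vo_setSc, NState.vo_setVi, NState.vo_setVo,
      NState.steps_bump, NState.steps_setSc, NState.steps_setVi, NState.steps_setVo, NState.peak_bump, NState.peak_setSc, NState.peak_setVi,
      NState.peak_setVo, Function.update_apply, EmbeddingLike.apply_eq_iff_eq, reduceCtorEq, DivV.vv.injEq, DivS.iv.injEq, DivO.vo.injEq,
      InvV.pv.injEq, InvS.pm.injEq, InvS.ln.injEq,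
      ite_true, ite_false, not_false_eq_true, implies_true, Nat.max_zero, Nat.zero_max, Nat.le_add_right,
      List.take_length, List.drop_length, List.nil_append, List.append_nil, le_refl, List.take_append_drop, List.length_nil, List.length_append,
      List.length_reverse, List.length_take, length_mulCoeffs, List.take_take, Nat.min_self] at nT
  obtain ⟨tDA, tDB, tT, tT2, tQ, tRB, tG, tpA, tpB, tpF, tpG, tpH, tpC, tacc, tacc2, taccL, taccR, td, tn, tpk, tst⟩ :
      τ.vi (ν .DA) = [] ∧
      τ.vi (ν .DB) = [] ∧
      τ.vi (ν .T) = [] ∧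
      τ.vi (ν .T2) = [] ∧
      τ.vi (ν .Q) = [] ∧
      τ.vi (ν (.vv .RB)) = [] ∧
      τ.vi (ν (.vv .G)) = [] ∧
      τ.vi (ν (.vv (.pv .A))) = [] ∧
      τ.vi (ν (.vv (.pv .B))) = [] ∧
      τ.vi (ν (.vv (.pv .F))) = [] ∧
      τ.vi (ν (.vv (.pv .G))) = [] ∧
      τ.vi (ν (.vv (.pv .H))) = [] ∧
      τ.vi (ν (.vv (.pv .C))) = [] ∧
      τ.vo (ω (.vo .acc)) = [] ∧
      τ.vo (ω (.vo .acc2)) = [] ∧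
      τ.vo (ω (.vo .accL)) = [] ∧
      τ.vo (ω .accR) = σ.vo (ω .accR) ++ linc (σ.sc (ρ (.iv (.pm .n)))) 1 1 A C2 d ∧
      τ.sc (ρ .d) = d ∧
      τ.sc (ρ (.iv (.pm .n))) = σ.sc (ρ (.iv (.pm .n))) ∧
      τ.peak = ((linP (InvS.lnE.trans (DivS.ivE.trans ρ)) (ν .DA) (ν (.vv (.pv .C))) (ω .accR) : NCom S V O E).eval 𝓔 X4).peak ∧
      τ.steps = ((linP (InvS.lnE.trans (DivS.ivE.trans ρ)) (ν .DA) (ν (.vv (.pv .C))) (ω .accR) : NCom S V O E).eval 𝓔 X4).steps + ((List.drop d A).length + 1) + ((List.drop d C2).length + 1) + ((List.take d B.reverse).length + 1) := by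
    rw [nT]; simp only [l1, l2, l3, lDB, lT, lT2, lQ, lRB, lG, lpA, lpB, lpF, lpG, lpH, lacc, lacc2, laccL, ld, ln', ← hGdef, ← hRA, ← hC1, ← hQl, ← hC2, hA', hB, htB, hdB, htA, hdA, hRBl, hGl, htG, hdG, hRAl, hC1d, hC1t, hdt, hQll, htQ, hdQ, hC2l, hC2d, NState.sc_bump, NState.sc_setSc, NState.sc_setVi, NState.sc_setVo, NState.vi_bump,
      NState.vi_setSc, NState.vi_setVi, NState.vi_setVo, NState.vo_bump, NState.vo_setSc, NState.vo_setVi, NState.vo_setVo,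
      NState.steps_bump, NState.steps_setSc, NState.steps_setVi, NState.steps_setVo, NState.peak_bump, NState.peak_setSc, NState.peak_setVi,
      NState.peak_setVo, Function.update_apply, EmbeddingLike.apply_eq_iff_eq, reduceCtorEq, DivV.vv.injEq, DivS.iv.injEq, DivO.vo.injEq,
      InvV.pv.injEq, InvS.pm.injEq, InvS.ln.injEq,
      ite_true, ite_false, not_false_eq_true, implies_true, Nat.max_zero, Nat.zero_max, Nat.le_add_right,
      List.take_length, List.drop_length, List.nil_append, List.append_nil, le_refl, List.take_append_drop, List.length_nil, List.length_append,
      List.length_reverse, List.length_take, length_mulCoeffs, List.take_take, Nat.min_self, and_self, and_true, true_and]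
  have t_w : ∀ w, (∀ i, w ≠ ν i) → τ.vi w = σ.vi w := fun w hw => by
    rw [← e_w w hw, ← wv w (hw .DA) (hw (.vv (.pv .C))), nT]; simp only [hw, l1, l2, l3, lDB, lT, lT2, lQ, lRB, lG, lpA, lpB, lpF, lpG, lpH, lacc, lacc2, laccL, ld, ln', ← hGdef, ← hRA, ← hC1, ← hQl, ← hC2, hA', hB, htB, hdB, htA, hdA, hRBl, hGl, htG, hdG, hRAl, hC1d, hC1t, hdt, hQll, htQ, hdQ, hC2l, hC2d, NState.sc_bump, NState.sc_setSc, NState.sc_setVi, NState.sc_setVo, NState.vi_bump,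
      NState.vi_setSc, NState.vi_setVi, NState.vi_setVo, NState.vo_bump, NState.vo_setSc, NState.vo_setVi, NState.vo_setVo,
      NState.steps_bump, NState.steps_setSc, NState.steps_setVi, NState.steps_setVo, NState.peak_bump, NState.peak_setSc, NState.peak_setVi,
      NState.peak_setVo, Function.update_apply, EmbeddingLike.apply_eq_iff_eq, reduceCtorEq, DivV.vv.injEq, DivS.iv.injEq, DivO.vo.injEq,
      InvV.pv.injEq, InvS.pm.injEq, InvS.ln.injEq,
      ite_true, ite_false, not_false_eq_true, implies_true, Nat.max_zero, Nat.zero_max, Nat.le_add_right,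
      List.take_length, List.drop_length, List.nil_append, List.append_nil, le_refl, List.take_append_drop, List.length_nil, List.length_append,
      List.length_reverse, List.length_take, length_mulCoeffs, List.take_take, Nat.min_self]
  have t_p : ∀ p, (∀ i, p ≠ ω i) → τ.vo p = σ.vo p := fun p hp => by
    rw [← e_p p hp, ← wo p (hp .accR), nT]; simp only [hp, l1, l2, l3, lDB, lT, lT2, lQ, lRB, lG, lpA, lpB, lpF, lpG, lpH, lacc, lacc2, laccL, ld, ln', ← hGdef, ← hRA, ← hC1, ← hQl, ← hC2, hA', hB, htB, hdB, htA, hdA, hRBl, hGl, htG, hdG, hRAl, hC1d, hC1t, hdt, hQll, htQ, hdQ, hC2l, hC2d, NState.sc_bump, NState.sc_setSc, NState.sc_setVi, NState.sc_setVo, NState.vi_bump,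
      NState.vi_setSc, NState.vi_setVi, NState.vi_setVo, NState.vo_bump, NState.vo_setSc, NState.vo_setVi, NState.vo_setVo,
      NState.steps_bump, NState.steps_setSc, NState.steps_setVi, NState.steps_setVo, NState.peak_bump, NState.peak_setSc, NState.peak_setVi,
      NState.peak_setVo, Function.update_apply, EmbeddingLike.apply_eq_iff_eq, reduceCtorEq, DivV.vv.injEq, DivS.iv.injEq, DivO.vo.injEq,
      InvV.pv.injEq, InvS.pm.injEq, InvS.ln.injEq,
      ite_true, ite_false, not_false_eq_true, implies_true, Nat.max_zero, Nat.zero_max, Nat.le_add_right,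
      List.take_length, List.drop_length, List.nil_append, List.append_nil, le_refl, List.take_append_drop, List.length_nil, List.length_append,
      List.length_reverse, List.length_take, length_mulCoeffs, List.take_take, Nat.min_self]
  have t_r : ∀ s', (∀ i, s' ≠ ρ i) → τ.sc s' = σ.sc s' := fun s' hr => by
    rw [← e_r s' hr, ← l5 s' (fun i => hr (.iv (.ln i))), nT]; simp only [hr, l1, l2, l3, lDB, lT, lT2, lQ, lRB, lG, lpA, lpB, lpF, lpG, lpH, lacc, lacc2, laccL, ld, ln', ← hGdef, ← hRA, ← hC1, ← hQl, ← hC2, hA', hB, htB, hdB, htA, hdA, hRBl, hGl, htG, hdG, hRAl, hC1d, hC1t, hdt, hQll, htQ, hdQ, hC2l, hC2d, NState.sc_bump, NState.sc_setSc, NState.sc_setVi, NState.sc_setVo, NState.vi_bump,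
      NState.vi_setSc, NState.vi_setVi, NState.vi_setVo, NState.vo_bump, NState.vo_setSc, NState.vo_setVi, NState.vo_setVo,
      NState.steps_bump, NState.steps_setSc, NState.steps_setVi, NState.steps_setVo, NState.peak_bump, NState.peak_setSc, NState.peak_setVi,
      NState.peak_setVo, Function.update_apply, EmbeddingLike.apply_eq_iff_eq, reduceCtorEq, DivV.vv.injEq, DivS.iv.injEq, DivO.vo.injEq,
      InvV.pv.injEq, InvS.pm.injEq, InvS.ln.injEq,
      ite_true, ite_false, not_false_eq_true, implies_true, Nat.max_zero, Nat.zero_max, Nat.le_add_right,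
      List.take_length, List.drop_length, List.nil_append, List.append_nil, le_refl, List.take_append_drop, List.length_nil, List.length_append,
      List.length_reverse, List.length_take, length_mulCoeffs, List.take_take, Nat.min_self]
  clear nT
  -- the mathematics of the remainder
  have hrem : linc (σ.sc (ρ (.iv (.pm .n)))) 1 1 A C2 d =
      coeffList (σ.sc (ρ (.iv (.pm .n)))) d (listPoly (σ.sc (ρ (.iv (.pm .n)))) A %ₘ listPoly (σ.sc (ρ (.iv (.pm .n)))) B) := by
    rw [hC2, hQl, hC1, hRA, hGdef]; exact div_remainder_eq hN hd hA hB hlast (hGdef ▸ hGl) (hGdef ▸ i3)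
  have hext : (divP M ρ ν ω : NCom S V O E).extOK 𝓔 σ := by
    show ((divS1 ρ ν ω ;ₙ (invP M ρi νi ωi ;ₙ (divS2 ρ ν ω ;ₙ (pmulP M ρq νq (ω (.vo .acc)) ;ₙ (divS3 ρ ν ω ;ₙ (pmulP M ρq νq (ω (.vo .acc)) ;ₙ
      (divS4 ρ ;ₙ (linP ρm (ν .DA) (ν (.vv (.pv .C))) (ω .accR) ;ₙ divS5 ν)))))))) : NCom S V O E).extOK 𝓔 σ
    rw [extOK_seq, extOK_seq, extOK_seq, extOK_seq, extOK_seq, extOK_seq, extOK_seq, extOK_seq, ← hX1', ← hY1, ← hX2', ← hY2, ← hX3', ← hY3, ← hX4]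
    refine ⟨extOK_of_noExt 𝓔 (divS_noExt ρ ν ω).1 σ, i21, extOK_of_noExt 𝓔 (divS_noExt ρ ν ω).2.1 _, ?_,
      extOK_of_noExt 𝓔 (divS_noExt ρ ν ω).2.2.1 _, ?_, extOK_of_noExt 𝓔 (divS_noExt ρ ν ω).2.2.2.1 _,
      extOK_of_noExt 𝓔 (linP_noExt _ _ _ _) _, extOK_of_noExt 𝓔 (divS_noExt ρ ν ω).2.2.2.2 _⟩
    · exact pmulP_extOK (𝓔 := 𝓔) M ρq νq (ω (.vo .acc)) X2
        (by show 1 < X2.sc (ρ (.iv (.pm .n))); rw [bn]; exact hN) (by show Odd (X2.sc (ρ (.iv (.pm .n)))); rw [bn]; exact hodd)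
        (by show X2.sc (ρ (.iv (.pm .la))) = (X2.vi (ν (.vv (.pv .A)))).length; rw [bla, bpA, hRAl])
        (by show X2.sc (ρ (.iv (.pm .lb))) = (X2.vi (ν (.vv (.pv .B)))).length; rw [blb, bpB, hGl])
        (by show 0 < (X2.vi (ν (.vv (.pv .A)))).length; rw [bpA, hRAl]; exact hd) (by show 0 < (X2.vi (ν (.vv (.pv .B)))).length; rw [bpB, hGl]; exact hd)
        (by show ∀ x ∈ X2.vi (ν (.vv (.pv .A))), x < X2.sc (ρ (.iv (.pm .n))); rw [bpA, bn, hRA]; exact hRAN)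
        (by show ∀ x ∈ X2.vi (ν (.vv (.pv .B))), x < X2.sc (ρ (.iv (.pm .n))); rw [bpB, bn]; exact hGN) bpF bpG bacc
    · exact pmulP_extOK (𝓔 := 𝓔) M ρq νq (ω (.vo .acc)) X3
        (by show 1 < X3.sc (ρ (.iv (.pm .n))); rw [cn]; exact hN) (by show Odd (X3.sc (ρ (.iv (.pm .n)))); rw [cn]; exact hodd)
        (by show X3.sc (ρ (.iv (.pm .la))) = (X3.vi (ν (.vv (.pv .A)))).length; rw [cla, cpA, hQll])
        (by show X3.sc (ρ (.iv (.pm .lb))) = (X3.vi (ν (.vv (.pv .B)))).length; rw [clb, cpB, hB])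
        (by show 0 < (X3.vi (ν (.vv (.pv .A)))).length; rw [cpA, hQll]; exact hd) (by show 0 < (X3.vi (ν (.vv (.pv .B)))).length; rw [cpB, hB]; exact Nat.succ_pos d)
        (by show ∀ x ∈ X3.vi (ν (.vv (.pv .A))), x < X3.sc (ρ (.iv (.pm .n))); rw [cpA, cn]; exact hQN)
        (by show ∀ x ∈ X3.vi (ν (.vv (.pv .B))), x < X3.sc (ρ (.iv (.pm .n))); rw [cpB, cn]; exact hBN) cpF cpG cacc
  refine ⟨by rw [taccR, hrem], tDA, tDB, tT, tT2, tQ, tRB, tG, tpA, tpB, tpF, tpG, tpH, tpC, tacc, tacc2, taccL, t_w, t_p, t_r, td, tn, ?_, ?_, hext⟩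
  · -- peak
    rw [tpk]
    have e1 := l8
    have e2 := qpk; rw [cpk, cn] at e2
    have e3 := ppk; rw [bpk, bn] at e3
    have e4 := i19; rw [apk] at e4
    generalize ((linP (InvS.lnE.trans (DivS.ivE.trans ρ)) (ν .DA) (ν (.vv (.pv .C))) (ω .accR) : NCom S V O E).eval 𝓔 X4).peak = Lp at e1 ⊢
    clear * - e1 e2 e3 e4 hd hN
    omega
  · -- steps
    rw [tst, List.length_drop, List.length_drop, hA, hC2l, hRBl]
    have e1 := l9
    have e2 := qst; 
    have e3 := cst
    have e4 := pst
    have e5 := bst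
    have e6 := i20; rw [aG, List.length_nil] at e6
    have e7 := ast
    have hc6 : M.cost (2 * (d + (d + 1))) = M.cost (4 * d + 2) := by congr 1; ring
    have hc4 : M.cost (2 * (d + d)) = M.cost (4 * d) := by congr 1; ring
    rw [hc6] at e2; rw [hc4] at e4
    generalize ((linP (InvS.lnE.trans (DivS.ivE.trans ρ)) (ν .DA) (ν (.vv (.pv .C))) (ω .accR) : NCom S V O E).eval 𝓔 X4).steps = Ls at e1 ⊢
    clear * - e1 e2 e3 e4 e5 e6 e7 hd
    omega

end Div

end NCom

end Literature.Computability.Complexity
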